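import Literature.NumberTheory.LFunctions.SatheSelbergComplexProduct
import Mathlib.Analysis.Complex.CauchyIntegral
import Mathlib.Analysis.Complex.Liouville
import Mathlib.Analysis.SpecialFunctions.Stirling
import Mathlib.MeasureTheory.Integral.Gamma
import HarnessLib

/-!
# The Sathe–Selberg formula for `ω` from Selberg's mean value of `z^{ω(n)}`

Topic `NumberTheory/LFunctions`; proofs file for `SatheSelberg.lean` (the named fact
`MontgomeryVaughan2007_exercise_7_4_3c`: for every `R > 0`, uniformly for `1 ≤ k ≤ R log log x`,
`ρ_k(x) = #{n ≤ x : ω(n) = k} = G_x((k-1)/log log x) · x(log log x)^{k-1}/((k-1)! log x) ·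
(1 + O_R(k/(log log x)²))`). Everything in this file is PROVED; there are no named facts.

## Main result

* `SatheSelberg.MontgomeryVaughan2007_exercise_7_4_3c_of_omegaMeanValue` — the fact follows from
  **Selberg's mean value formula for `z^{ω(n)}`**, taken as an explicit hypothesis:
  for every `R > 0` there is `C` with
  `|∑_{n ≤ x} z^{ω(n)} - F_x(z)/Γ(z) · x (log x)^{z-1}| ≤ C x (log x)^{Re z - 2}` for all
  integers `x ≥ 2` and complex `|z| ≤ R`, where `F_x(z) = ∏_{p ≤ x}(1 + z/(p-1))(1-1/p)^z`
  (`satheSelbergFC`). This hypothesis is Montgomery–Vaughan, *Multiplicative Number Theory I*,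
  Theorem 7.18 applied to the Euler product of §7.4.1 Exercise 3(a)–(b) (for which `a_z(n) =
  z^{ω(n)}`), i.e. Selberg's 1954 formula, proved in print by the Selberg–Delange method
  (Perron's formula for `ζ(s)^z F(s,z)`, a Hankel contour around `s = 1` inside the classical
  zero-free region, Hankel's formula for `1/Γ`); that analytic input is NOT proved here (the tree
  has the zero-free region, `log ζ` and the prime number theorem with error term, but not yet the
  Selberg–Delange theorem), which is why the discharge `MontgomeryVaughan2007_exercise_7_4_3c_holds`
  is not in this file yet. What IS proved here is the entire passage from the mean value to `ρ_k`.

## The argument (Montgomery–Vaughan, proof of Theorem 7.19, p. 180, transcribed for `ω`)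

With `L = log x`, `L₂ = log log x`, `A(z) = ∑_{n ≤ x} z^{ω(n)} = ∑_k ρ_k(x) z^k` (a polynomial):

1. `ρ_k(x) = (2πi)⁻¹ ∮_{|z|=r} A(z) z^{-k-1} dz` (7.61) (`distinctPrimeFactorCount_eq_circleIntegral`,
   from `∮ z^m z^{-k-1} dz = 2πi δ_{mk}`).
2. Insert the mean value `A = M + E`, `M(z) = F_x(z)/Γ(z) x L^{z-1} = (x/L) z G_x(z) e^{L₂ z}`
   (`1/Γ(z) = z/Γ(z+1)`, `G_x = F_x/Γ(·+1)` = `satheSelbergGC`): `ρ_k = (x/L)(2πi)⁻¹∮ G_x(z)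
   e^{L₂z} z^{-k} dz + (2πi)⁻¹∮ E(z) z^{-k-1} dz` (`distinctPrimeFactorCount_eq_main_add_error`), and
   the error integral is `≤ C₁ x L^{r-2} r^{-k}` for `r ≤ R`, `L ≥ 1` (`norm_errorIntegral_le`).
3. `k = 1`: on `|z| = 1/L₂` Cauchy's formula gives the main integral EXACTLY `G_x(0) = 1`
   (`mainIntegral_one`), so `|ρ₁ - x/L| ≤ C₁ e x L₂/L²` (`abs_sub_le_case_one`). (Montgomery–Vaughan
   quote the prime number theorem instead; the mean value at small radius contains it.)
4. `k ≥ 2`, `r = (k-1)/L₂` (7.63): `G(z) = G(r) + G'(r)(z-r) + Q(z)`; `∮ e^{L₂z} z^{-k} dz =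
   2πi L₂^{k-1}/(k-1)!` (Cauchy's formula for derivatives of `e^{L₂ z}`), the LINEAR term integrates
   to `G'(r)·2πi[L₂^{k-2}/(k-2)! - r L₂^{k-1}/(k-1)!] = 0` at this radius (`mainIntegral_two_le`),
   and `|Q(z)| ≤ 2M|z-r|²` where `M` bounds `|G_x|` on `|w| ≤ R+1` uniformly in `x`
   (`norm_taylor_two_remainder_le` via Cauchy's estimate; `exists_bound_satheSelbergGC`, the tail
   factors being `1 + O_R(1/p²)`), so the remainder integral is
   `≤ 2M r³ r^{-k} ∫_0^{2π} |e^{iθ}-1|² e^{(k-1)cos θ} dθ ≤ 2M r³ r^{-k} · C_F e^{k-1}(k-1)^{-3/2}`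
   (`norm_remainderIntegral_le`, `exists_bound_angular_integral`: `2 - 2cos θ ≤ θ²`,
   `cos θ ≤ 1 - 2θ²/π²`, and the Gaussian second moment).
5. Stirling `n! ≤ e√n(n/e)^n` (`factorial_le_stirling_upper`, from Mathlib's monotone Stirling
   sequence) turns both bounds into `≪ (main term)·k/L₂²`, the error integral with the extra factor
   `L₂³/L → 0` (`abs_sub_le_case_two_le`, `numeric_ineq_one/two`); the main term is `≫` its size
   because `G_x(r) ≥ e^{-8R²}/max_{[1,R+1]} Γ > 0` (`exists_pos_le_satheSelbergG`). The threshold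
   `x₀(R)` collects `log x ≥ 1`, `log log x ≥ max(1, 1/R)` and `(log log x)³ ≪_R log x`.

## References

* [MontgomeryVaughan2007] H. L. Montgomery, R. C. Vaughan, *Multiplicative Number Theory I.
  Classical Theory*, CUP 2007, §7.4: Theorems 7.17–7.19, (7.61)–(7.63), proof of Theorem 7.19
  (p. 180), §7.4.1 Exercise 3 (p. 182). doi:10.1017/CBO9780511618314
* [Selberg1954] A. Selberg, *Note on a paper by L. G. Sathe*, J. Indian Math. Soc. 18 (1954) 83–87.
-/

noncomputable section

open Complex MeasureTheory Set Filter Finset intervalIntegral Metric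

namespace Literature.NumberTheory.LFunctions

namespace SatheSelberg


/-! ### (A) Coefficient extraction from a polynomial in `z` by Cauchy's formula -/

/-- Points of a circle of positive radius about `0` are non-zero. [folklore] -/
theorem ne_zero_of_mem_sphere_zero {r : ℝ} (hr : 0 < r) {z : ℂ} (hz : z ∈ sphere (0 : ℂ) r) :
    z ≠ 0 := by
  rintro rfl
  rw [mem_sphere, dist_self] at hz
  exact hr.ne' hz.symm

/-- `∮_{|z|=r} z^m / z^{k+1} dz = 2πi` if `m = k` and `0` otherwise (`r > 0`). [folklore] -/
theorem circleIntegral_pow_div_pow_succ (m k : ℕ) {r : ℝ} (hr : 0 < r) :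
    (∮ z in C(0, r), z ^ m / z ^ (k + 1)) = if m = k then 2 * Real.pi * I else 0 := by
  split_ifs with h
  · rw [← circleIntegral.integral_sub_center_inv 0 hr.ne']
    refine circleIntegral.integral_congr hr.le fun z hz => ?_
    have hz0 := ne_zero_of_mem_sphere_zero hr hz
    simp only [sub_zero]
    rw [h, pow_succ, ← div_div, div_self (pow_ne_zero _ hz0), one_div]
  · have hne : ((m : ℤ) - ((k + 1 : ℕ) : ℤ)) ≠ -1 := by push_cast; omega
    calc (∮ z in C(0, r), z ^ m / z ^ (k + 1))
        = ∮ z in C(0, r), (z - 0) ^ ((m : ℤ) - ((k + 1 : ℕ) : ℤ)) := by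
          refine circleIntegral.integral_congr hr.le fun z hz => ?_
          have hz0 := ne_zero_of_mem_sphere_zero hr hz
          simp only [sub_zero]
          rw [zpow_sub₀ hz0, zpow_natCast, zpow_natCast]
      _ = 0 := circleIntegral.integral_sub_zpow_of_ne hne 0 0 r

/-- **Coefficient extraction**: for a finite family of monomials `z^{f n}`,
`∮_{|z|=r} (∑_n z^{f n}) / z^{k+1} dz = 2πi · #{n : f n = k}` (`r > 0`). [folklore] -/
theorem circleIntegral_sum_pow_div_pow_succ (S : Finset ℕ) (f : ℕ → ℕ) (k : ℕ) {r : ℝ}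
    (hr : 0 < r) :
    (∮ z in C(0, r), (∑ n ∈ S, z ^ (f n)) / z ^ (k + 1)) =
      2 * Real.pi * I * ((S.filter (fun n => f n = k)).card : ℂ) := by
  calc (∮ z in C(0, r), (∑ n ∈ S, z ^ (f n)) / z ^ (k + 1))
      = ∮ z in C(0, r), ∑ n ∈ S, z ^ (f n) / z ^ (k + 1) := by simp_rw [Finset.sum_div]
    _ = ∑ n ∈ S, ∮ z in C(0, r), z ^ (f n) / z ^ (k + 1) := by
        refine circleIntegral.integral_fun_sum fun n _ => ?_
        refine ContinuousOn.circleIntegrable hr.le ?_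
        refine ContinuousOn.div (by fun_prop) (by fun_prop) fun z hz => ?_
        exact pow_ne_zero _ (ne_zero_of_mem_sphere_zero hr hz)
    _ = ∑ n ∈ S, (if f n = k then 2 * Real.pi * I else 0) :=
        Finset.sum_congr rfl fun n _ => circleIntegral_pow_div_pow_succ (f n) k hr
    _ = 2 * Real.pi * I * ((S.filter (fun n => f n = k)).card : ℂ) := by
        rw [Finset.sum_ite, Finset.sum_const_zero, add_zero, Finset.sum_const, nsmul_eq_mul,
          mul_comm]

/-! ### (B) `∮ e^{Lz} z^{-(n+1)} dz` -/

/-- `∮_{|z|=r} e^{Lz}/z^{n+1} dz = 2πi Lⁿ/n!` (`r > 0`): Cauchy's formula for the `n`-th derivative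
of the entire function `e^{Lz}` at `0`. [folklore] -/
theorem circleIntegral_exp_mul_div_pow_succ (L : ℂ) (n : ℕ) {r : ℝ} (hr : 0 < r) :
    (∮ z in C(0, r), Complex.exp (L * z) / z ^ (n + 1)) =
      2 * Real.pi * I / n.factorial * L ^ n := by
  have hd : DifferentiableOn ℂ (fun z : ℂ => Complex.exp (L * z)) (closedBall 0 r) := by
    fun_prop
  have h := hd.circleIntegral_one_div_sub_center_pow_smul hr n
  simp only [sub_zero, smul_eq_mul, one_div, iteratedDeriv_cexp_const_mul, mul_zero,
    Complex.exp_zero, mul_one] at h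
  rw [← h]
  refine circleIntegral.integral_congr hr.le fun z _ => ?_
  simp only [div_eq_inv_mul]

/-- The main-term integral of Montgomery–Vaughan (7.63):
`∮_{|z|=r} G e^{Lz}/z^k dz` for CONSTANT `G` and `k ≥ 1` is `2πi G L^{k-1}/(k-1)!`. [folklore] -/
theorem circleIntegral_const_mul_exp_mul_div_pow (G L : ℂ) {k : ℕ} (hk : 1 ≤ k) {r : ℝ}
    (hr : 0 < r) :
    (∮ z in C(0, r), G * Complex.exp (L * z) / z ^ k) =
      2 * Real.pi * I / (k - 1).factorial * L ^ (k - 1) * G := by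
  obtain ⟨n, rfl⟩ : ∃ n, k = n + 1 := ⟨k - 1, by omega⟩
  simp only [add_tsub_cancel_right]
  simp_rw [mul_div_assoc]
  rw [circleIntegral.integral_const_mul, circleIntegral_exp_mul_div_pow_succ L n hr]
  ring

/-! ### (F) The angular integral `∫_0^{2π} |e^{iθ} - 1|² e^{κ cos θ} dθ ≪ e^κ κ^{-3/2}` -/

/-- `|e^{iθ} - 1|² = 2 - 2 cos θ`. [folklore] -/
theorem norm_exp_mul_I_sub_one_sq (θ : ℝ) :
    ‖Complex.exp (θ * I) - 1‖ ^ 2 = 2 - 2 * Real.cos θ := by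
  rw [Complex.sq_norm, Complex.normSq_apply]
  simp only [sub_re, exp_ofReal_mul_I_re, one_re, sub_im, exp_ofReal_mul_I_im, one_im, sub_zero]
  nlinarith [Real.sin_sq_add_cos_sq θ]

/-- On `[0, π]`: `(2 - 2cos θ) e^{κ cos θ} ≤ θ² e^κ e^{-(2κ/π²) θ²}` for `κ ≥ 0`, from
`cos θ ≥ 1 - θ²/2` and `cos θ ≤ 1 - 2θ²/π²` (`|θ| ≤ π`). [folklore] -/
theorem two_sub_two_cos_mul_exp_le {κ θ : ℝ} (hκ : 0 ≤ κ) (h0 : 0 ≤ θ) (hπ : θ ≤ Real.pi) :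
    (2 - 2 * Real.cos θ) * Real.exp (κ * Real.cos θ) ≤
      θ ^ 2 * (Real.exp κ * Real.exp (-(2 * κ / Real.pi ^ 2) * θ ^ 2)) := by
  have h1 : 2 - 2 * Real.cos θ ≤ θ ^ 2 := by
    have := Real.one_sub_sq_div_two_le_cos (x := θ); linarith
  have h2 : Real.cos θ ≤ 1 - 2 / Real.pi ^ 2 * θ ^ 2 :=
    Real.cos_le_one_sub_mul_cos_sq (by rw [abs_of_nonneg h0]; exact hπ)
  have h3 : Real.exp (κ * Real.cos θ) ≤ Real.exp κ * Real.exp (-(2 * κ / Real.pi ^ 2) * θ ^ 2) := by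
    rw [← Real.exp_add, Real.exp_le_exp]
    have := mul_le_mul_of_nonneg_left h2 hκ
    have h4 : κ * (1 - 2 / Real.pi ^ 2 * θ ^ 2) = κ + -(2 * κ / Real.pi ^ 2) * θ ^ 2 := by ring
    linarith
  have h5 : 0 ≤ 2 - 2 * Real.cos θ := by linarith [Real.cos_le_one θ]
  exact mul_le_mul h1 h3 (Real.exp_pos _).le (sq_nonneg _)

/-- The Gaussian second moment on `(0, ∞)`: `∫_0^∞ θ² e^{-b θ²} dθ = b^{-3/2} · Γ(3/2)/2` (`b > 0`).
[folklore] -/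
theorem integral_sq_mul_exp_neg_mul_sq {b : ℝ} (hb : 0 < b) :
    ∫ θ in Ioi (0 : ℝ), θ ^ 2 * Real.exp (-b * θ ^ 2) =
      b ^ (-(3 : ℝ) / 2) * (1 / 2) * Real.Gamma (3 / 2) := by
  have h := integral_rpow_mul_exp_neg_mul_rpow (p := 2) (q := 2) (b := b) two_pos
    (by norm_num) hb
  simp only [Real.rpow_two] at h
  rw [h]
  norm_num

/-- **The angular integral**: there is an absolute constant `C` such that for all `κ ≥ 1`,
`∫_0^{2π} |e^{iθ} - 1|² e^{κ cos θ} dθ ≤ C e^κ κ^{-3/2}` (Montgomery–Vaughan p. 180: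
"`≪ ∫ (sin πθ)² e^{(k-1)cos 2πθ} dθ ≪ e^{k-1}(k-1)^{-3/2}`").
[cite: MontgomeryVaughan2007, proof of Theorem 7.19] -/
theorem exists_bound_angular_integral :
    ∃ C : ℝ, 0 < C ∧ ∀ κ : ℝ, 1 ≤ κ →
      ∫ θ in (0 : ℝ)..2 * Real.pi, ‖Complex.exp (θ * I) - 1‖ ^ 2 * Real.exp (κ * Real.cos θ) ≤
        C * Real.exp κ * κ ^ (-(3 : ℝ) / 2) := by
  refine ⟨2 * ((2 / Real.pi ^ 2) ^ (-(3 : ℝ) / 2) * (1 / 2) * Real.Gamma (3 / 2)),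
    by positivity, fun κ hκ => ?_⟩
  have hκ0 : 0 ≤ κ := by linarith
  set g : ℝ → ℝ := fun θ => ‖Complex.exp (θ * I) - 1‖ ^ 2 * Real.exp (κ * Real.cos θ) with hg
  have hgc : Continuous g := by
    rw [hg]; fun_prop
  set b : ℝ := 2 * κ / Real.pi ^ 2 with hb
  have hbpos : 0 < b := by rw [hb]; positivity
  set h : ℝ → ℝ := fun θ => θ ^ 2 * Real.exp (-b * θ ^ 2) with hh
  have hhc : Continuous h := by rw [hh]; fun_prop
  -- pointwise bound on `[0, π]`
  have hgh : ∀ θ ∈ Icc 0 Real.pi, g θ ≤ Real.exp κ * h θ := by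
    intro θ hθ
    simp only [hg, hh]
    rw [norm_exp_mul_I_sub_one_sq]
    have := two_sub_two_cos_mul_exp_le hκ0 hθ.1 hθ.2
    calc _ ≤ θ ^ 2 * (Real.exp κ * Real.exp (-(2 * κ / Real.pi ^ 2) * θ ^ 2)) := this
      _ = Real.exp κ * (θ ^ 2 * Real.exp (-b * θ ^ 2)) := by rw [hb]; ring
  -- symmetry `θ ↦ 2π - θ`
  have hsymm : ∫ θ in Real.pi..2 * Real.pi, g θ = ∫ θ in (0 : ℝ)..Real.pi, g θ := by
    have h1 : ∫ θ in Real.pi..2 * Real.pi, g θ = ∫ θ in Real.pi..2 * Real.pi, g (2 * Real.pi - θ) := by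
      refine intervalIntegral.integral_congr fun θ _ => ?_
      simp only [hg]
      rw [norm_exp_mul_I_sub_one_sq, norm_exp_mul_I_sub_one_sq, Real.cos_two_pi_sub]
    rw [h1, intervalIntegral.integral_comp_sub_left (fun θ => g θ) (2 * Real.pi)]
    norm_num [sub_self, two_mul]
  have hsplit : ∫ θ in (0 : ℝ)..2 * Real.pi, g θ =
      (∫ θ in (0 : ℝ)..Real.pi, g θ) + ∫ θ in Real.pi..2 * Real.pi, g θ :=
    (intervalIntegral.integral_add_adjacent_intervals (hgc.intervalIntegrable _ _)
      (hgc.intervalIntegrable _ _)).symm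
  -- the half integral
  have hhalf : ∫ θ in (0 : ℝ)..Real.pi, g θ ≤
      Real.exp κ * (b ^ (-(3 : ℝ) / 2) * (1 / 2) * Real.Gamma (3 / 2)) := by
    calc ∫ θ in (0 : ℝ)..Real.pi, g θ ≤ ∫ θ in (0 : ℝ)..Real.pi, Real.exp κ * h θ :=
          intervalIntegral.integral_mono_on Real.pi_pos.le (hgc.intervalIntegrable _ _)
            ((continuous_const.mul hhc).intervalIntegrable _ _) hgh
      _ = Real.exp κ * ∫ θ in (0 : ℝ)..Real.pi, h θ := by
          rw [intervalIntegral.integral_const_mul]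
      _ ≤ Real.exp κ * ∫ θ in Ioi (0 : ℝ), h θ := by
          gcongr
          rw [intervalIntegral.integral_of_le Real.pi_pos.le]
          refine setIntegral_mono_set ?_ ?_ ?_
          · simpa [hh, Real.rpow_two] using integrableOn_rpow_mul_exp_neg_mul_sq hbpos
              (s := 2) (by norm_num)
          · exact Eventually.of_forall fun θ => by simp only [Pi.zero_apply, hh]; positivity
          · exact Eventually.of_forall Ioc_subset_Ioi_self
      _ = Real.exp κ * (b ^ (-(3 : ℝ) / 2) * (1 / 2) * Real.Gamma (3 / 2)) := by
          rw [hh, integral_sq_mul_exp_neg_mul_sq hbpos]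
  -- `b^{-3/2} = (2/π²)^{-3/2} κ^{-3/2}`
  have hbpow : b ^ (-(3 : ℝ) / 2) = (2 / Real.pi ^ 2) ^ (-(3 : ℝ) / 2) * κ ^ (-(3 : ℝ) / 2) := by
    rw [hb, show 2 * κ / Real.pi ^ 2 = 2 / Real.pi ^ 2 * κ by ring,
      Real.mul_rpow (by positivity) hκ0]
  rw [hsplit, hsymm, ← two_mul]
  calc 2 * ∫ θ in (0 : ℝ)..Real.pi, g θ
      ≤ 2 * (Real.exp κ * (b ^ (-(3 : ℝ) / 2) * (1 / 2) * Real.Gamma (3 / 2))) := by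
        gcongr
    _ = _ := by rw [hbpow]; ring



/-! ### (C) Taylor's formula to second order with a uniform remainder, from a sup bound -/

/-- Cauchy's estimate for the second derivative of an entire function bounded by `M` on the disc
`|w| ≤ ρ + 1`: `‖G''(w)‖ ≤ 2M` for `|w| ≤ ρ`. [folklore] -/
theorem norm_deriv_deriv_le {G : ℂ → ℂ} (hG : Differentiable ℂ G) {M ρ : ℝ}
    (hM : ∀ w : ℂ, ‖w‖ ≤ ρ + 1 → ‖G w‖ ≤ M) {w : ℂ} (hw : ‖w‖ ≤ ρ) :
    ‖deriv (deriv G) w‖ ≤ 2 * M := by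
  have h := Complex.norm_iteratedDeriv_le_of_forall_mem_sphere_norm_le (c := w) (R := 1) (C := M)
    (f := G) 2 one_pos hG.diffContOnCl (fun z hz => hM z ?_)
  · simpa [iteratedDeriv_succ, Nat.factorial] using h
  · have h1 : ‖z - w‖ = 1 := by simpa [dist_eq_norm] using hz
    calc ‖z‖ = ‖(z - w) + w‖ := by ring_nf
      _ ≤ ‖z - w‖ + ‖w‖ := norm_add_le _ _
      _ ≤ ρ + 1 := by rw [h1]; linarith

/-- **Second-order Taylor remainder** for an entire function `G` with `‖G‖ ≤ M` on `|w| ≤ ρ + 1`: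
for `|a|, |z| ≤ ρ`, `‖G(z) - G(a) - G'(a)(z - a)‖ ≤ 2M |z - a|²` (Montgomery–Vaughan p. 180:
"`G(z) - G(r) - G'(r)(z-r) = ∫_r^z (z-w)G''(w) dw ≪ |z-r|²`"; here via the mean value inequality
applied to `G'` and to `w ↦ G(w) - G(a) - G'(a)(w-a)` on the segment `[a, z]`).
[cite: MontgomeryVaughan2007, proof of Theorem 7.19] -/
theorem norm_taylor_two_remainder_le {G : ℂ → ℂ} (hG : Differentiable ℂ G) {M ρ : ℝ}
    (hM : ∀ w : ℂ, ‖w‖ ≤ ρ + 1 → ‖G w‖ ≤ M) {a z : ℂ} (ha : ‖a‖ ≤ ρ) (hz : ‖z‖ ≤ ρ) :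
    ‖G z - G a - deriv G a * (z - a)‖ ≤ 2 * M * ‖z - a‖ ^ 2 := by
  -- the closed ball `|w| ≤ ρ` is convex and contains the segment `[a, z]`
  have hball : Convex ℝ (closedBall (0 : ℂ) ρ) := convex_closedBall 0 ρ
  have ha' : a ∈ closedBall (0 : ℂ) ρ := by simpa using ha
  have hz' : z ∈ closedBall (0 : ℂ) ρ := by simpa using hz
  have hseg : segment ℝ a z ⊆ closedBall (0 : ℂ) ρ := hball.segment_subset ha' hz'
  have hdG : Differentiable ℂ (deriv G) := hG.deriv
  -- `‖G'(u) - G'(a)‖ ≤ 2M ‖u - a‖` on the ball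
  have h1 : ∀ u ∈ closedBall (0 : ℂ) ρ, ‖deriv G u - deriv G a‖ ≤ 2 * M * ‖u - a‖ := by
    intro u hu
    exact hball.norm_image_sub_le_of_norm_deriv_le (f := deriv G) (fun w _ => hdG.differentiableAt)
      (fun w hw => norm_deriv_deriv_le hG hM (by simpa using hw)) ha' hu
  -- apply the mean value inequality to `Φ(u) = G u - G a - G'(a)(u - a)` on the segment
  set Φ : ℂ → ℂ := fun u => G u - G a - deriv G a * (u - a) with hΦ
  have hΦd : ∀ u, HasDerivAt Φ (deriv G u - deriv G a) u := by
    intro u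
    have h1' : HasDerivAt G (deriv G u) u := hG.differentiableAt.hasDerivAt
    have h2 : HasDerivAt (fun u : ℂ => deriv G a * (u - a)) (deriv G a * 1) u :=
      ((hasDerivAt_id u).sub_const a).const_mul (deriv G a)
    have h3 := (h1'.sub_const (G a)).fun_sub h2
    rw [mul_one] at h3
    exact h3
  have hbound : ∀ u ∈ segment ℝ a z, ‖deriv Φ u‖ ≤ 2 * M * ‖z - a‖ := by
    intro u hu
    rw [(hΦd u).deriv]
    refine (h1 u (hseg hu)).trans ?_
    gcongr
    · linarith [norm_nonneg (G a), hM a (by linarith [norm_nonneg a])]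
    · -- `‖u - a‖ ≤ ‖z - a‖` on the segment
      obtain ⟨t, ht, rfl⟩ := (segment_eq_image ℝ a z ▸ hu :
        u ∈ (fun t : ℝ => (1 - t) • a + t • z) '' Icc (0 : ℝ) 1)
      have : (1 - t) • a + t • z - a = t • (z - a) := by
        simp only [real_smul, Complex.ofReal_sub, Complex.ofReal_one]; ring
      rw [this, norm_smul, Real.norm_eq_abs, abs_of_nonneg ht.1]
      calc t * ‖z - a‖ ≤ 1 * ‖z - a‖ := by gcongr; exact ht.2
        _ = ‖z - a‖ := one_mul _
  have hconv : Convex ℝ (segment ℝ a z) := convex_segment a z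
  have h3 := hconv.norm_image_sub_le_of_norm_deriv_le (f := Φ)
    (fun u _ => (hΦd u).differentiableAt) hbound (left_mem_segment ℝ a z)
    (right_mem_segment ℝ a z)
  have hΦa : Φ a = 0 := by simp [hΦ]
  have hΦz : Φ z = G z - G a - deriv G a * (z - a) := rfl
  rw [hΦa, sub_zero, hΦz] at h3
  calc _ ≤ 2 * M * ‖z - a‖ * ‖z - a‖ := h3
    _ = 2 * M * ‖z - a‖ ^ 2 := by ring

/-! ### (S) Stirling: an explicit upper bound for `n!` -/

/-- **Stirling upper bound**: `n! ≤ e √n (n/e)^n` for `n ≥ 1` (the Stirling sequence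
`n!/(√(2n)(n/e)^n)` is decreasing and equals `e/√2` at `n = 1`). [folklore] -/
theorem factorial_le_stirling_upper {n : ℕ} (hn : 1 ≤ n) :
    (n.factorial : ℝ) ≤ Real.exp 1 * Real.sqrt n * ((n : ℝ) / Real.exp 1) ^ n := by
  obtain ⟨m, rfl⟩ : ∃ m, n = m + 1 := ⟨n - 1, by omega⟩
  have hanti := Stirling.stirlingSeq'_antitone (Nat.zero_le m)
  simp only [Function.comp_apply, Nat.succ_eq_add_one, zero_add, Stirling.stirlingSeq_one] at hanti
  -- `stirlingSeq (m+1) ≤ e/√2`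
  have hpos : 0 < Real.sqrt (2 * ((m + 1 : ℕ) : ℝ)) * (((m + 1 : ℕ) : ℝ) / Real.exp 1) ^ (m + 1) := by
    positivity
  have h1 : ((m + 1).factorial : ℝ) ≤
      Real.exp 1 / Real.sqrt 2 * (Real.sqrt (2 * ((m + 1 : ℕ) : ℝ)) *
        (((m + 1 : ℕ) : ℝ) / Real.exp 1) ^ (m + 1)) := by
    rw [← div_le_iff₀ hpos]
    exact hanti
  calc ((m + 1).factorial : ℝ) ≤ _ := h1
    _ = Real.exp 1 * Real.sqrt ((m + 1 : ℕ) : ℝ) * (((m + 1 : ℕ) : ℝ) / Real.exp 1) ^ (m + 1) := by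
        rw [Real.sqrt_mul' _ (by positivity)]
        field_simp

/-- `n! eⁿ ≤ e √n nⁿ` for `n ≥ 1`. [folklore] -/
theorem factorial_mul_exp_le {n : ℕ} (hn : 1 ≤ n) :
    (n.factorial : ℝ) * Real.exp n ≤ Real.exp 1 * Real.sqrt n * (n : ℝ) ^ n := by
  have h := factorial_le_stirling_upper hn
  have he : Real.exp (n : ℝ) = (Real.exp 1) ^ n := by
    rw [← Real.exp_one_rpow, Real.rpow_natCast]
  rw [div_pow] at h
  have hpos : 0 < Real.exp 1 ^ n := by positivity
  calc (n.factorial : ℝ) * Real.exp n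
      ≤ Real.exp 1 * Real.sqrt n * ((n : ℝ) ^ n / Real.exp 1 ^ n) * Real.exp 1 ^ n := by
        rw [he]; gcongr
    _ = Real.exp 1 * Real.sqrt n * (n : ℝ) ^ n := by field_simp

/-- `n! eⁿ √n ≤ e · n · nⁿ` for `n ≥ 1`. [folklore] -/
theorem factorial_mul_exp_mul_sqrt_le {n : ℕ} (hn : 1 ≤ n) :
    (n.factorial : ℝ) * Real.exp n * Real.sqrt n ≤ Real.exp 1 * n * (n : ℝ) ^ n := by
  have h := factorial_mul_exp_le hn
  have hs : Real.sqrt n * Real.sqrt n = (n : ℝ) := Real.mul_self_sqrt (Nat.cast_nonneg n)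
  calc (n.factorial : ℝ) * Real.exp n * Real.sqrt n
      ≤ Real.exp 1 * Real.sqrt n * (n : ℝ) ^ n * Real.sqrt n := by gcongr
    _ = Real.exp 1 * (Real.sqrt n * Real.sqrt n) * (n : ℝ) ^ n := by ring
    _ = Real.exp 1 * n * (n : ℝ) ^ n := by rw [hs]

/-! ### (H) Thresholds in `x` -/

/-- For every `A`, eventually `A (log log x)^3 ≤ log x`. [folklore] -/
theorem eventually_mul_log_log_pow_three_le_log (A : ℝ) :
    ∀ᶠ x : ℕ in atTop, A * Real.log (Real.log (x : ℝ)) ^ 3 ≤ Real.log (x : ℝ) := by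
  -- `(log L)^3 / L → 0` as `L → ∞`, with `L = log x → ∞`
  have h1 : Tendsto (fun L : ℝ => Real.log L ^ 3 / (1 * L + 0)) atTop (nhds 0) :=
    Real.tendsto_pow_log_div_mul_add_atTop 1 0 3 one_ne_zero
  simp only [one_mul, add_zero] at h1
  have h2 := h1.comp (Real.tendsto_log_atTop.comp tendsto_natCast_atTop_atTop)
  have h3 : ∀ᶠ x : ℕ in atTop, Real.log (Real.log (x : ℝ)) ^ 3 / Real.log (x : ℝ) ≤ 1 / (|A| + 1) :=
    (h2.eventually (eventually_le_nhds (by positivity)))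
  have h4 : ∀ᶠ x : ℕ in atTop, 1 ≤ Real.log (x : ℝ) :=
    (Real.tendsto_log_atTop.comp tendsto_natCast_atTop_atTop).eventually (eventually_ge_atTop 1)
  filter_upwards [h3, h4] with x hx hL
  have hL0 : 0 < Real.log (x : ℝ) := by linarith
  rw [div_le_div_iff₀ hL0 (by positivity), one_mul] at hx
  have h5 : 0 ≤ Real.log (Real.log (x : ℝ)) ^ 3 := by
    have : 0 ≤ Real.log (Real.log (x : ℝ)) := Real.log_nonneg hL
    positivity
  calc A * Real.log (Real.log (x : ℝ)) ^ 3 ≤ |A| * Real.log (Real.log (x : ℝ)) ^ 3 := by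
        gcongr; exact le_abs_self A
    _ ≤ (|A| + 1) * Real.log (Real.log (x : ℝ)) ^ 3 := by gcongr; linarith
    _ = Real.log (Real.log (x : ℝ)) ^ 3 * (|A| + 1) := by ring
    _ ≤ Real.log (x : ℝ) := hx



/-- The two elementary bounds on `ℓ_p = log(1 - 1/p)`: `-1/(p-1) ≤ ℓ_p ≤ -1/p`; hence
`0 ≤ 1/(p-1) + ℓ_p ≤ 1/(p-1)²` and `|ℓ_p| ≤ 1`. [folklore] -/
theorem log_one_sub_one_div_bounds {p : ℕ} (hp : p.Prime) :
    -(1 / ((p : ℝ) - 1)) ≤ Real.log (1 - 1 / (p : ℝ)) ∧ Real.log (1 - 1 / (p : ℝ)) ≤ -(1 / (p : ℝ)) := by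
  have hp2 : (2 : ℝ) ≤ p := by exact_mod_cast hp.two_le
  have hp0 : (0 : ℝ) < p := by linarith
  have hq : (0 : ℝ) < 1 - 1 / (p : ℝ) := by
    have : 1 / (p : ℝ) ≤ 1 / 2 := one_div_le_one_div_of_le (by norm_num) hp2
    linarith
  have hp1 : (p : ℝ) - 1 ≠ 0 := by linarith
  have hp0' : (p : ℝ) ≠ 0 := hp0.ne'
  constructor
  · have h := Real.one_sub_inv_le_log_of_pos hq
    have e1 : (1 : ℝ) - 1 / (p : ℝ) = ((p : ℝ) - 1) / (p : ℝ) := by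
      field_simp
    have e2 : (1 - 1 / (p : ℝ))⁻¹ = (p : ℝ) / ((p : ℝ) - 1) := by
      rw [e1, inv_div]
    have e3 : 1 - (p : ℝ) / ((p : ℝ) - 1) = -(1 / ((p : ℝ) - 1)) := by
      field_simp
      ring
    rw [e2] at h
    linarith
  · have h := Real.log_le_sub_one_of_pos hq
    linarith

/-- (D1) A single Euler factor at a large prime: for `2|w| ≤ p - 1`,
`|(1 + w/(p-1))(1 - 1/p)^w| ≤ exp((|w|² + |w|)/(p-1)²)`. [cite: MontgomeryVaughan2007, §7.4.1 Exercise 3(a)] -/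
theorem norm_truncFactor_le_exp {p : ℕ} (hp : p.Prime) {w : ℂ} (hw : 2 * ‖w‖ ≤ (p : ℝ) - 1) :
    ‖((1 : ℂ) + w / ((p : ℂ) - 1)) * ((1 : ℂ) - 1 / (p : ℂ)) ^ w‖ ≤
      Real.exp ((‖w‖ ^ 2 + ‖w‖) / ((p : ℝ) - 1) ^ 2) := by
  have hp2 : (2 : ℝ) ≤ p := by exact_mod_cast hp.two_le
  have hp1 : (0 : ℝ) < (p : ℝ) - 1 := by linarith
  have hq : (0 : ℝ) < 1 - 1 / (p : ℝ) := by
    have : 1 / (p : ℝ) ≤ 1 / 2 := one_div_le_one_div_of_le (by norm_num) hp2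
    linarith
  obtain ⟨hℓ1, hℓ2⟩ := log_one_sub_one_div_bounds hp
  set ℓ : ℝ := Real.log (1 - 1 / (p : ℝ)) with hℓ
  set u : ℂ := w / ((p : ℂ) - 1) with hu
  have hpc : ((p : ℂ) - 1) = (((p : ℝ) - 1 : ℝ) : ℂ) := by push_cast; ring
  have hu_norm : ‖u‖ = ‖w‖ / ((p : ℝ) - 1) := by
    rw [hu, norm_div, hpc, Complex.norm_real, Real.norm_eq_abs, abs_of_pos hp1]
  have hu_half : ‖u‖ ≤ 1 / 2 := by
    rw [hu_norm, div_le_iff₀ hp1]; linarith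
  have hu_lt : ‖u‖ < 1 := by linarith
  -- the power of the positive real base
  have hbase : (1 : ℂ) - 1 / (p : ℂ) = (((1 - 1 / (p : ℝ) : ℝ)) : ℂ) := by push_cast; ring
  have hcpow : ((1 : ℂ) - 1 / (p : ℂ)) ^ w = Complex.exp (w * (ℓ : ℂ)) := by
    rw [hbase, Complex.cpow_def_of_ne_zero (by exact_mod_cast hq.ne'), ← Complex.ofReal_log hq.le,
      mul_comm]
  -- `1 + u = exp (log (1 + u))`
  have h1u : (1 : ℂ) + u ≠ 0 := by
    intro h
    have : ‖u‖ = 1 := by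
      have : u = -1 := by linear_combination h
      rw [this, norm_neg, norm_one]
    linarith
  have hexp1u : (1 : ℂ) + u = Complex.exp (Complex.log (1 + u)) := (Complex.exp_log h1u).symm
  -- assemble: the factor is `exp (log(1+u) + w ℓ)`
  have hfac : ((1 : ℂ) + w / ((p : ℂ) - 1)) * ((1 : ℂ) - 1 / (p : ℂ)) ^ w =
      Complex.exp (Complex.log (1 + u) + w * (ℓ : ℂ)) := by
    rw [Complex.exp_add, ← hexp1u, hcpow]
  rw [hfac, Complex.norm_exp, Real.exp_le_exp]
  -- real part estimate
  have hlog : ‖Complex.log (1 + u) - u‖ ≤ ‖u‖ ^ 2 := by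
    have h := Complex.norm_log_one_add_sub_self_le hu_lt
    have h2 : (1 - ‖u‖)⁻¹ ≤ 2 := by
      rw [inv_le_comm₀ (by linarith) two_pos]; linarith
    calc _ ≤ ‖u‖ ^ 2 * (1 - ‖u‖)⁻¹ / 2 := h
      _ ≤ ‖u‖ ^ 2 * 2 / 2 := by gcongr
      _ = ‖u‖ ^ 2 := by ring
  have hre1 : (Complex.log (1 + u)).re ≤ ‖u‖ ^ 2 + u.re := by
    have : (Complex.log (1 + u)).re = (Complex.log (1 + u) - u).re + u.re := by simp
    rw [this]
    have := (Complex.re_le_norm (Complex.log (1 + u) - u)).trans hlog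
    linarith
  have hure : u.re = w.re / ((p : ℝ) - 1) := by
    rw [hu, hpc, Complex.div_ofReal_re]
  have hwℓ : (w * (ℓ : ℂ)).re = w.re * ℓ := by simp [Complex.mul_re]
  rw [Complex.add_re, hwℓ]
  -- `u.re + w.re ℓ = w.re (1/(p-1) + ℓ)` and `0 ≤ 1/(p-1) + ℓ ≤ 1/(p-1)²`
  have hsum_nonneg : 0 ≤ 1 / ((p : ℝ) - 1) + ℓ := by linarith
  have hsum_le : 1 / ((p : ℝ) - 1) + ℓ ≤ 1 / ((p : ℝ) - 1) ^ 2 := by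
    have hp0 : (0 : ℝ) < p := by linarith
    have : 1 / ((p : ℝ) - 1) - 1 / (p : ℝ) ≤ 1 / ((p : ℝ) - 1) ^ 2 := by
      rw [div_sub_div _ _ hp1.ne' hp0.ne', div_le_div_iff₀ (by positivity) (by positivity)]
      nlinarith
    linarith
  have hkey : u.re + w.re * ℓ ≤ ‖w‖ / ((p : ℝ) - 1) ^ 2 := by
    rw [hure]
    have : w.re / ((p : ℝ) - 1) + w.re * ℓ = w.re * (1 / ((p : ℝ) - 1) + ℓ) := by ring
    rw [this]
    calc w.re * (1 / ((p : ℝ) - 1) + ℓ) ≤ ‖w‖ * (1 / ((p : ℝ) - 1) + ℓ) := by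
          gcongr; exact Complex.re_le_norm w
      _ ≤ ‖w‖ * (1 / ((p : ℝ) - 1) ^ 2) := by gcongr
      _ = ‖w‖ / ((p : ℝ) - 1) ^ 2 := by ring
  have hu2 : ‖u‖ ^ 2 = ‖w‖ ^ 2 / ((p : ℝ) - 1) ^ 2 := by rw [hu_norm, div_pow]
  calc (Complex.log (1 + u)).re + w.re * ℓ ≤ ‖u‖ ^ 2 + (u.re + w.re * ℓ) := by linarith
    _ ≤ ‖w‖ ^ 2 / ((p : ℝ) - 1) ^ 2 + ‖w‖ / ((p : ℝ) - 1) ^ 2 := by rw [hu2]; gcongr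
    _ = (‖w‖ ^ 2 + ‖w‖) / ((p : ℝ) - 1) ^ 2 := by ring

/-- (D2) A single Euler factor at any prime: for `|w| ≤ R`,
`|(1 + w/(p-1))(1 - 1/p)^w| ≤ (1 + R) e^R`. [cite: MontgomeryVaughan2007, §7.4.1 Exercise 3(a)] -/
theorem norm_truncFactor_le {p : ℕ} (hp : p.Prime) {w : ℂ} {R : ℝ} (hw : ‖w‖ ≤ R) :
    ‖((1 : ℂ) + w / ((p : ℂ) - 1)) * ((1 : ℂ) - 1 / (p : ℂ)) ^ w‖ ≤ (1 + R) * Real.exp R := by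
  have hp2 : (2 : ℝ) ≤ p := by exact_mod_cast hp.two_le
  have hp1 : (1 : ℝ) ≤ (p : ℝ) - 1 := by linarith
  have hq : (0 : ℝ) < 1 - 1 / (p : ℝ) := by
    have : 1 / (p : ℝ) ≤ 1 / 2 := one_div_le_one_div_of_le (by norm_num) hp2
    linarith
  have hR : 0 ≤ R := (norm_nonneg w).trans hw
  obtain ⟨hℓ1, hℓ2⟩ := log_one_sub_one_div_bounds hp
  have hpc : ((p : ℂ) - 1) = (((p : ℝ) - 1 : ℝ) : ℂ) := by push_cast; ring
  have hbase : (1 : ℂ) - 1 / (p : ℂ) = (((1 - 1 / (p : ℝ) : ℝ)) : ℂ) := by push_cast; ring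
  rw [norm_mul]
  refine mul_le_mul ?_ ?_ (norm_nonneg _) (by linarith)
  · calc ‖(1 : ℂ) + w / ((p : ℂ) - 1)‖ ≤ ‖(1 : ℂ)‖ + ‖w / ((p : ℂ) - 1)‖ := norm_add_le _ _
      _ = 1 + ‖w‖ / ((p : ℝ) - 1) := by
          rw [norm_one, norm_div, hpc, Complex.norm_real, Real.norm_eq_abs,
            abs_of_pos (by linarith)]
      _ ≤ 1 + R := by
          gcongr
          calc ‖w‖ / ((p : ℝ) - 1) ≤ ‖w‖ / 1 := by gcongr
            _ ≤ R := by rw [div_one]; exact hw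
  · rw [hbase, Complex.norm_cpow_eq_rpow_re_of_pos hq, Real.rpow_def_of_pos hq, Real.exp_le_exp]
    have h1 : |Real.log (1 - 1 / (p : ℝ))| ≤ 1 := by
      rw [abs_le]
      have h3 : 1 / ((p : ℝ) - 1) ≤ 1 := by
        rw [div_le_one (by linarith)]; linarith
      have h4 : 0 < 1 / (p : ℝ) := by positivity
      constructor <;> linarith
    calc Real.log (1 - 1 / (p : ℝ)) * w.re ≤ |Real.log (1 - 1 / (p : ℝ)) * w.re| := le_abs_self _
      _ = |Real.log (1 - 1 / (p : ℝ))| * |w.re| := abs_mul _ _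
      _ ≤ 1 * ‖w‖ := by
          gcongr
          exact Complex.abs_re_le_norm w
      _ ≤ R := by rw [one_mul]; exact hw

/-- `∑_{p ≤ x} 1/(p-1)² ≤ 8`. [folklore] -/
theorem sum_primesLE_one_div_sub_one_sq_le (x : ℕ) :
    ∑ p ∈ Nat.primesLE x, 1 / ((p : ℝ) - 1) ^ 2 ≤ 8 := by
  have h1 : ∀ p ∈ Nat.primesLE x, 1 / ((p : ℝ) - 1) ^ 2 ≤ 4 * ((p : ℝ) ^ 2)⁻¹ := by
    intro p hp
    have hp2 : (2 : ℝ) ≤ p := by exact_mod_cast (Nat.mem_primesLE.1 hp).2.two_le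
    have hp1 : (0 : ℝ) < (p : ℝ) - 1 := by linarith
    have e : 4 * ((p : ℝ) ^ 2)⁻¹ = 4 * ((p : ℝ) - 1) ^ 2 / ((p : ℝ) ^ 2 * ((p : ℝ) - 1) ^ 2) := by
      field_simp
    rw [e, div_le_div_iff₀ (by positivity) (by positivity)]
    nlinarith [mul_nonneg (mul_nonneg (by linarith : (0:ℝ) ≤ (p:ℝ) - 2)
      (by linarith : (0:ℝ) ≤ 3 * (p:ℝ) - 2)) (sq_nonneg ((p:ℝ) - 1))]
  have h2 : Nat.primesLE x ⊆ Finset.Ioo 0 (x + 1) := by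
    intro p hp
    obtain ⟨hpx, hpp⟩ := Nat.mem_primesLE.1 hp
    simp only [Finset.mem_Ioo]
    exact ⟨hpp.pos, Nat.lt_succ_of_le hpx⟩
  calc ∑ p ∈ Nat.primesLE x, 1 / ((p : ℝ) - 1) ^ 2
      ≤ ∑ p ∈ Nat.primesLE x, 4 * ((p : ℝ) ^ 2)⁻¹ := Finset.sum_le_sum h1
    _ ≤ ∑ p ∈ Finset.Ioo 0 (x + 1), 4 * ((p : ℝ) ^ 2)⁻¹ :=
        Finset.sum_le_sum_of_subset_of_nonneg h2 fun p _ _ => by positivity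
    _ = 4 * ∑ p ∈ Finset.Ioo 0 (x + 1), ((p : ℝ) ^ 2)⁻¹ := by rw [Finset.mul_sum]
    _ ≤ 4 * 2 := by
        gcongr
        have := sum_Ioo_inv_sq_le (α := ℝ) 0 (x + 1)
        norm_num at this
        exact this
    _ = 8 := by norm_num

/-- (D3) **Uniform bound for `F_x`**: for every `R ≥ 0` there is `M` with `|F_x(w)| ≤ M` for all
`x` and all `|w| ≤ R` (the tail factors are `1 + O_R(1/p²)`).
[cite: MontgomeryVaughan2007, §7.4.1 Exercise 3(a)] -/
theorem exists_bound_satheSelbergFC (R : ℝ) (hR : 0 ≤ R) :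
    ∃ M : ℝ, 0 < M ∧ ∀ x : ℕ, ∀ w : ℂ, ‖w‖ ≤ R → ‖satheSelbergFC x w‖ ≤ M := by
  set K : ℝ := (1 + R) * Real.exp R with hK
  have hK1 : 1 ≤ K := by
    have := Real.one_le_exp hR
    calc (1 : ℝ) = 1 * 1 := by ring
      _ ≤ (1 + R) * Real.exp R := mul_le_mul (by linarith) this zero_le_one (by linarith)
  set N : ℕ := ⌊2 * R⌋₊ + 2 with hN
  refine ⟨K ^ N * Real.exp ((R ^ 2 + R) * 8), by positivity, fun x w hw => ?_⟩
  -- pointwise bound on each factor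
  set b : ℕ → ℝ := fun p => (if (p : ℝ) < 2 * R + 1 then K else 1) *
    Real.exp ((R ^ 2 + R) * (1 / ((p : ℝ) - 1) ^ 2)) with hb
  have hfac : ∀ p ∈ Nat.primesLE x,
      ‖((1 : ℂ) + w / ((p : ℂ) - 1)) * ((1 : ℂ) - 1 / (p : ℂ)) ^ w‖ ≤ b p := by
    intro p hp
    have hpp := (Nat.mem_primesLE.1 hp).2
    simp only [hb]
    by_cases hsmall : (p : ℝ) < 2 * R + 1
    · rw [if_pos hsmall]
      calc _ ≤ K := norm_truncFactor_le hpp hw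
        _ ≤ K * Real.exp ((R ^ 2 + R) * (1 / ((p : ℝ) - 1) ^ 2)) := by
            have : 1 ≤ Real.exp ((R ^ 2 + R) * (1 / ((p : ℝ) - 1) ^ 2)) :=
              Real.one_le_exp (by positivity)
            nlinarith
    · rw [if_neg hsmall, one_mul]
      have hsmall' := not_lt.1 hsmall
      have h2w : 2 * ‖w‖ ≤ (p : ℝ) - 1 := by linarith
      calc _ ≤ Real.exp ((‖w‖ ^ 2 + ‖w‖) / ((p : ℝ) - 1) ^ 2) := norm_truncFactor_le_exp hpp h2w
        _ ≤ Real.exp ((R ^ 2 + R) * (1 / ((p : ℝ) - 1) ^ 2)) := by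
            rw [Real.exp_le_exp, mul_one_div]
            gcongr
  calc ‖satheSelbergFC x w‖ = ∏ p ∈ Nat.primesLE x,
        ‖((1 : ℂ) + w / ((p : ℂ) - 1)) * ((1 : ℂ) - 1 / (p : ℂ)) ^ w‖ := by
        rw [satheSelbergFC_apply, norm_prod]
    _ ≤ ∏ p ∈ Nat.primesLE x, b p := Finset.prod_le_prod (fun p _ => norm_nonneg _) hfac
    _ = (∏ p ∈ Nat.primesLE x, (if (p : ℝ) < 2 * R + 1 then K else 1)) *
          Real.exp ((R ^ 2 + R) * ∑ p ∈ Nat.primesLE x, 1 / ((p : ℝ) - 1) ^ 2) := by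
        rw [hb, Finset.prod_mul_distrib, Finset.mul_sum, Real.exp_sum]
    _ ≤ K ^ N * Real.exp ((R ^ 2 + R) * 8) := by
        gcongr
        · -- the small primes
          rw [Finset.prod_ite, Finset.prod_const_one, mul_one, Finset.prod_const]
          refine pow_le_pow_right₀ hK1 ?_
          refine (Finset.card_le_card (t := Finset.range N) fun p hp => ?_).trans
            (Finset.card_range N).le
          simp only [Finset.mem_filter] at hp
          simp only [Finset.mem_range, hN]
          have h1 : (p : ℝ) < 2 * R + 1 := hp.2
          have h2 : (2 * R : ℝ) < ⌊2 * R⌋₊ + 1 := Nat.lt_floor_add_one _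
          have h3 : (p : ℝ) < (⌊2 * R⌋₊ + 2 : ℕ) := by push_cast; linarith
          exact_mod_cast h3
        · exact sum_primesLE_one_div_sub_one_sq_le x

/-- (D4) **Uniform bound for `G_x = F_x/Γ(·+1)`** on `|w| ≤ R`, uniformly in `x`.
[cite: MontgomeryVaughan2007, proof of Theorem 7.19] -/
theorem exists_bound_satheSelbergGC (R : ℝ) (hR : 0 ≤ R) :
    ∃ M : ℝ, 0 < M ∧ ∀ x : ℕ, ∀ w : ℂ, ‖w‖ ≤ R → ‖satheSelbergGC x w‖ ≤ M := by
  obtain ⟨M₁, hM₁, h₁⟩ := exists_bound_satheSelbergFC R hR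
  -- `1/Γ(w+1)` is continuous, hence bounded on the closed disc
  have hcont : ContinuousOn (fun w : ℂ => (Complex.Gamma (w + 1))⁻¹) (Metric.closedBall 0 R) :=
    (Complex.differentiable_one_div_Gamma.comp (differentiable_id.add_const 1)).continuous.continuousOn
  obtain ⟨M₂, hM₂⟩ := (isCompact_closedBall (0 : ℂ) R).exists_bound_of_continuousOn hcont
  have hM₂' : 0 ≤ M₂ := (norm_nonneg _).trans (hM₂ 0 (Metric.mem_closedBall_self hR))
  refine ⟨M₁ * M₂ + 1, by positivity, fun x w hw => ?_⟩
  have hw' : w ∈ Metric.closedBall (0 : ℂ) R := by simpa using hw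
  rw [satheSelbergGC_apply, div_eq_mul_inv, norm_mul]
  calc ‖satheSelbergFC x w‖ * ‖(Complex.Gamma (w + 1))⁻¹‖ ≤ M₁ * M₂ :=
        mul_le_mul (h₁ x w hw) (hM₂ w hw') (norm_nonneg _) hM₁.le
    _ ≤ M₁ * M₂ + 1 := by linarith

/-! ### (E) Lower bound for `G_x(r)`, `0 ≤ r ≤ R` -/

/-- (E1) A single real Euler factor is at least `exp(-(r/(p-1))²)` for `r ≥ 0`.
[cite: MontgomeryVaughan2007, §7.4.1 Exercise 3(a)] -/
theorem exp_neg_sq_le_truncFactor {p : ℕ} (hp : p.Prime) {r : ℝ} (hr : 0 ≤ r) :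
    Real.exp (-(r / ((p : ℝ) - 1)) ^ 2) ≤ (1 + r / ((p : ℝ) - 1)) * (1 - 1 / (p : ℝ)) ^ r := by
  have hp2 : (2 : ℝ) ≤ p := by exact_mod_cast hp.two_le
  have hp1 : (0 : ℝ) < (p : ℝ) - 1 := by linarith
  have hq : (0 : ℝ) < 1 - 1 / (p : ℝ) := by
    have : 1 / (p : ℝ) ≤ 1 / 2 := one_div_le_one_div_of_le (by norm_num) hp2
    linarith
  obtain ⟨hℓ1, -⟩ := log_one_sub_one_div_bounds hp
  set u : ℝ := r / ((p : ℝ) - 1) with hu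
  have hu0 : 0 ≤ u := by positivity
  -- `exp (u - u²) ≤ 1 + u`
  have h1 : Real.exp (u - u ^ 2) ≤ 1 + u := by
    rw [← Real.le_log_iff_exp_le (by linarith)]
    have h := Real.one_sub_inv_le_log_of_pos (x := 1 + u) (by linarith)
    have h2 : u - u ^ 2 ≤ 1 - (1 + u)⁻¹ := by
      rw [show (1 : ℝ) - (1 + u)⁻¹ = u / (1 + u) by field_simp; ring]
      rw [le_div_iff₀ (by linarith)]
      nlinarith [sq_nonneg u, mul_nonneg hu0 (sq_nonneg u)]
    linarith
  -- `exp (-u) ≤ (1 - 1/p)^r`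
  have h2 : Real.exp (-u) ≤ (1 - 1 / (p : ℝ)) ^ r := by
    rw [Real.rpow_def_of_pos hq, Real.exp_le_exp]
    have : -u = -(1 / ((p : ℝ) - 1)) * r := by rw [hu]; ring
    rw [this]
    exact mul_le_mul_of_nonneg_right hℓ1 hr
  calc Real.exp (-(u) ^ 2) = Real.exp (u - u ^ 2) * Real.exp (-u) := by
        rw [← Real.exp_add]; ring_nf
    _ ≤ (1 + u) * (1 - 1 / (p : ℝ)) ^ r :=
        mul_le_mul h1 h2 (Real.exp_pos _).le (by linarith)

/-- (E2) `F_x(r) ≥ exp(-8 r²)` for `r ≥ 0`. [cite: MontgomeryVaughan2007, §7.4.1 Exercise 3(a)] -/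
theorem exp_neg_le_satheSelbergF (x : ℕ) {r : ℝ} (hr : 0 ≤ r) :
    Real.exp (-(8 * r ^ 2)) ≤ satheSelbergF x r := by
  rw [satheSelbergF_apply]
  calc Real.exp (-(8 * r ^ 2)) ≤ Real.exp (-(r ^ 2 * ∑ p ∈ Nat.primesLE x, 1 / ((p : ℝ) - 1) ^ 2)) := by
        rw [Real.exp_le_exp, neg_le_neg_iff]
        have := sum_primesLE_one_div_sub_one_sq_le x
        nlinarith [sq_nonneg r]
    _ = ∏ p ∈ Nat.primesLE x, Real.exp (-(r / ((p : ℝ) - 1)) ^ 2) := by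
        rw [Finset.mul_sum, ← Finset.sum_neg_distrib, Real.exp_sum]
        refine Finset.prod_congr rfl fun p _ => ?_
        congr 1
        rw [div_pow]; ring
    _ ≤ ∏ p ∈ Nat.primesLE x, (1 + r / ((p : ℝ) - 1)) * (1 - 1 / (p : ℝ)) ^ r :=
        Finset.prod_le_prod (fun p _ => (Real.exp_pos _).le)
          fun p hp => exp_neg_sq_le_truncFactor (Nat.mem_primesLE.1 hp).2 hr

/-- (E3) **Uniform positive lower bound for `G_x(r)`**: for every `R ≥ 0` there is `c₀ > 0` with
`c₀ ≤ G_x(r)` for all `x` and all `0 ≤ r ≤ R` (Montgomery–Vaughan p. 180: "`G((k-1)/log log x) ≫ 1`").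
[cite: MontgomeryVaughan2007, proof of Theorem 7.19] -/
theorem exists_pos_le_satheSelbergG (R : ℝ) (hR : 0 ≤ R) :
    ∃ c₀ : ℝ, 0 < c₀ ∧ ∀ x : ℕ, ∀ r : ℝ, 0 ≤ r → r ≤ R → c₀ ≤ satheSelbergG x r := by
  -- `Γ` is continuous on `[1, R+1]`, hence bounded by some `B ≥ 1`
  have hcont : ContinuousOn Real.Gamma (Set.Icc 1 (R + 1)) := by
    intro s hs
    refine (Real.differentiableAt_Gamma fun m => ?_).continuousAt.continuousWithinAt
    have : (1 : ℝ) ≤ s := hs.1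
    intro h
    have : (0 : ℝ) ≤ m := Nat.cast_nonneg m
    linarith
  obtain ⟨B, hB⟩ := (isCompact_Icc (a := (1 : ℝ)) (b := R + 1)).exists_bound_of_continuousOn hcont
  have hB1 : 1 ≤ B := by
    have := hB 1 ⟨le_rfl, by linarith⟩
    rwa [Real.Gamma_one, Real.norm_eq_abs, abs_one] at this
  refine ⟨Real.exp (-(8 * R ^ 2)) / B, by positivity, fun x r hr hrR => ?_⟩
  have hΓpos : 0 < Real.Gamma (r + 1) := Real.Gamma_pos_of_pos (by linarith)
  have hΓle : Real.Gamma (r + 1) ≤ B := by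
    have := hB (r + 1) ⟨by linarith, by linarith⟩
    rwa [Real.norm_eq_abs, abs_of_pos hΓpos] at this
  rw [satheSelbergG_apply, le_div_iff₀ hΓpos]
  calc Real.exp (-(8 * R ^ 2)) / B * Real.Gamma (r + 1) ≤ Real.exp (-(8 * R ^ 2)) / B * B := by
        gcongr
    _ = Real.exp (-(8 * R ^ 2)) := by field_simp
    _ ≤ Real.exp (-(8 * r ^ 2)) := by
        rw [Real.exp_le_exp]; nlinarith [mul_nonneg hr hr, mul_nonneg hr (by linarith : 0 ≤ R - r)]
    _ ≤ satheSelbergF x r := exp_neg_le_satheSelbergF x hr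


/-! ### The main term of the mean value, divided by `z^{k+1}` -/

/-- For `L > 0` and `z ≠ 0`:
`F_x(z)/Γ(z) · x · L^{z-1} / z^{k+1} = (x/L) · G_x(z) e^{(log L) z} / z^k`
(`1/Γ(z) = z/Γ(z+1)` and `L^{z-1} = e^{z log L}/L`). [cite: MontgomeryVaughan2007, proof of Theorem 7.19] -/
theorem mainTerm_div_pow_succ (x : ℕ) {L : ℝ} (hL : 0 < L) {z : ℂ} (hz : z ≠ 0) (k : ℕ) :
    satheSelbergFC x z / Complex.Gamma z * (x : ℂ) * ((L : ℂ) ^ (z - 1)) / z ^ (k + 1) =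
      (x : ℂ) / (L : ℂ) *
        (satheSelbergGC x z * Complex.exp ((Real.log L : ℂ) * z) / z ^ k) := by
  have hΓ : (Complex.Gamma z)⁻¹ = z * (Complex.Gamma (z + 1))⁻¹ := by
    have := Complex.one_div_Gamma_eq_self_mul_one_div_Gamma_add_one z
    simpa only [one_div] using this
  have hLc : (L : ℂ) ≠ 0 := by exact_mod_cast hL.ne'
  have hcpow : (L : ℂ) ^ (z - 1) = Complex.exp ((Real.log L : ℂ) * z) / (L : ℂ) := by
    rw [Complex.cpow_def_of_ne_zero hLc, ← Complex.ofReal_log hL.le, mul_sub, mul_one,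
      Complex.exp_sub, ← Complex.ofReal_exp, Real.exp_log hL]
  rw [div_eq_mul_inv (satheSelbergFC x z), hΓ, hcpow, satheSelbergGC_apply, div_eq_mul_inv _
    (Complex.Gamma (z + 1))]
  generalize (Complex.Gamma (z + 1))⁻¹ = w
  rw [pow_succ]
  field_simp

/-- `ρ_k(x)` as a Cauchy integral: `ρ_k(x) = (2πi)⁻¹ ∮_{|z|=r} A_z(x) z^{-k-1} dz` where
`A_z(x) = ∑_{n ≤ x} z^{ω(n)}` (Montgomery–Vaughan (7.61)). [cite: MontgomeryVaughan2007, (7.61)] -/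
theorem distinctPrimeFactorCount_eq_circleIntegral (x k : ℕ) {r : ℝ} (hr : 0 < r) :
    (distinctPrimeFactorCount x k : ℂ) = (2 * Real.pi * I)⁻¹ *
      ∮ z in C(0, r), (∑ n ∈ Finset.Icc 1 x, z ^ (ArithmeticFunction.cardDistinctFactors n)) /
        z ^ (k + 1) := by
  rw [circleIntegral_sum_pow_div_pow_succ _ _ k hr, ← mul_assoc, inv_mul_cancel₀
    Complex.two_pi_I_ne_zero, one_mul]
  rfl

/-- Continuity of the main term `z ↦ F_x(z)/Γ(z) · x · L^{z-1}` (`1/Γ` is entire). [folklore] -/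
theorem continuous_mainTerm (x : ℕ) {L : ℝ} (hL : 0 < L) :
    Continuous fun z : ℂ => satheSelbergFC x z / Complex.Gamma z * (x : ℂ) * ((L : ℂ) ^ (z - 1)) := by
  have h1 : Continuous fun z : ℂ => satheSelbergFC x z / Complex.Gamma z := by
    have : (fun z : ℂ => satheSelbergFC x z / Complex.Gamma z) =
        fun z => satheSelbergFC x z * (Complex.Gamma z)⁻¹ := by
      funext z; rw [div_eq_mul_inv]
    rw [this]
    exact (differentiable_satheSelbergFC x).continuous.mul
      Complex.differentiable_one_div_Gamma.continuous
  have hLc : (L : ℂ) ≠ 0 := by exact_mod_cast hL.ne'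
  have h2 : Continuous fun z : ℂ => (L : ℂ) ^ (z - 1) :=
    Continuous.const_cpow (by fun_prop) (Or.inl hLc)
  exact (h1.mul continuous_const).mul h2

/-- **Splitting `ρ_k`**: with `L = log x`, `L₂ = log L`, `A(z) = ∑_{n ≤ x} z^{ω(n)}` and the
mean-value main term `M(z) = F_x(z)/Γ(z) · x · L^{z-1}`, for every `r > 0`,
`ρ_k(x) = (x/L) · (2πi)⁻¹ ∮_{|z|=r} G_x(z) e^{L₂ z} z^{-k} dz + (2πi)⁻¹ ∮_{|z|=r} (A - M)(z) z^{-k-1} dz`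
(Montgomery–Vaughan p. 180: "The main term we obtain from (7.61) is `xI/log x` …").
[cite: MontgomeryVaughan2007, proof of Theorem 7.19] -/
theorem distinctPrimeFactorCount_eq_main_add_error (x : ℕ) (hx : 2 ≤ x) {r : ℝ} (hr : 0 < r)
    (k : ℕ) :
    (distinctPrimeFactorCount x k : ℂ) =
      (x : ℂ) / (Real.log x : ℂ) * ((2 * Real.pi * I)⁻¹ *
        ∮ z in C(0, r), satheSelbergGC x z *
          Complex.exp ((Real.log (Real.log x) : ℂ) * z) / z ^ k) +
      (2 * Real.pi * I)⁻¹ * ∮ z in C(0, r),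
        ((∑ n ∈ Finset.Icc 1 x, z ^ (ArithmeticFunction.cardDistinctFactors n)) -
          satheSelbergFC x z / Complex.Gamma z * (x : ℂ) * ((Real.log x : ℂ) ^ (z - 1))) /
        z ^ (k + 1) := by
  have hL : 0 < Real.log x := Real.log_pos (by exact_mod_cast hx)
  set L : ℝ := Real.log x with hLdef
  set A : ℂ → ℂ := fun z => ∑ n ∈ Finset.Icc 1 x, z ^ (ArithmeticFunction.cardDistinctFactors n)
    with hA
  set Mx : ℂ → ℂ := fun z => satheSelbergFC x z / Complex.Gamma z * (x : ℂ) * ((L : ℂ) ^ (z - 1))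
    with hMx
  set Q₁ : ℂ → ℂ := fun z => (x : ℂ) / (L : ℂ) *
    (satheSelbergGC x z * Complex.exp ((Real.log L : ℂ) * z) / z ^ k) with hQ₁
  set Q₂ : ℂ → ℂ := fun z => (A z - Mx z) / z ^ (k + 1) with hQ₂
  have hAc : Continuous A := by rw [hA]; fun_prop
  have hMc : Continuous Mx := continuous_mainTerm x hL
  have hsplit : ∀ z ∈ sphere (0 : ℂ) r, A z / z ^ (k + 1) = Q₁ z + Q₂ z := by
    intro z hz
    have hz0 := ne_zero_of_mem_sphere_zero hr hz
    have h := mainTerm_div_pow_succ x hL hz0 k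
    simp only [hQ₁, hQ₂, hMx]
    rw [← h]
    ring
  have hQ₁i : CircleIntegrable Q₁ 0 r := by
    refine ContinuousOn.circleIntegrable hr.le ?_
    simp only [hQ₁]
    refine ContinuousOn.mul continuousOn_const (ContinuousOn.div ?_ (by fun_prop) fun z hz => ?_)
    · exact ((differentiable_satheSelbergGC x).continuous.mul (by fun_prop)).continuousOn
    · exact pow_ne_zero _ (ne_zero_of_mem_sphere_zero hr hz)
  have hQ₂i : CircleIntegrable Q₂ 0 r := by
    refine ContinuousOn.circleIntegrable hr.le ?_
    simp only [hQ₂]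
    refine ContinuousOn.div (hAc.sub hMc).continuousOn (by fun_prop) fun z hz => ?_
    exact pow_ne_zero _ (ne_zero_of_mem_sphere_zero hr hz)
  rw [distinctPrimeFactorCount_eq_circleIntegral x k hr]
  have hint : (∮ z in C(0, r), A z / z ^ (k + 1)) = (∮ z in C(0, r), Q₁ z) + ∮ z in C(0, r), Q₂ z := by
    rw [← circleIntegral.integral_add hQ₁i hQ₂i]
    exact circleIntegral.integral_congr hr.le fun z hz => hsplit z hz
  change (2 * Real.pi * I)⁻¹ * (∮ z in C(0, r), A z / z ^ (k + 1)) = _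
  rw [hint, hQ₁, circleIntegral.integral_const_mul]
  simp only [hQ₂, hA, hMx]
  ring

/-- **The error integral**: if `|A(z) - M(z)| ≤ C₁ x L^{Re z - 2}` on `|z| ≤ R` (`L = log x ≥ 1`,
`C₁ ≥ 0`), then for `0 < r ≤ R`, `|(2πi)⁻¹ ∮_{|z|=r} (A - M)(z) z^{-k-1} dz| ≤ C₁ x L^{r-2}/r^k`
(Montgomery–Vaughan p. 180: "The error term contributes an amount `≪ x(log x)^{r-2} r^{-k}`").
[cite: MontgomeryVaughan2007, proof of Theorem 7.19] -/
theorem norm_errorIntegral_le {E : ℂ → ℂ} {x C₁ R L r : ℝ} (hC₁ : 0 ≤ C₁) (hx : 0 ≤ x)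
    (hL : 1 ≤ L) (hr : 0 < r) (hrR : r ≤ R)
    (hE : ∀ z : ℂ, ‖z‖ ≤ R → ‖E z‖ ≤ C₁ * x * L ^ (z.re - 2)) (k : ℕ) :
    ‖(2 * Real.pi * I)⁻¹ * ∮ z in C(0, r), E z / z ^ (k + 1)‖ ≤ C₁ * x * L ^ (r - 2) / r ^ k := by
  have hbound : ∀ z ∈ sphere (0 : ℂ) r, ‖E z / z ^ (k + 1)‖ ≤ C₁ * x * L ^ (r - 2) / r ^ (k + 1) := by
    intro z hz
    have hzn : ‖z‖ = r := by simpa using hz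
    rw [norm_div, norm_pow, hzn]
    gcongr
    calc ‖E z‖ ≤ C₁ * x * L ^ (z.re - 2) := hE z (by rw [hzn]; exact hrR)
      _ ≤ C₁ * x * L ^ (r - 2) := by
          have h1 : L ^ (z.re - 2) ≤ L ^ (r - 2) :=
            Real.rpow_le_rpow_of_exponent_le hL
              (by linarith [(Complex.re_le_norm z).trans hzn.le])
          exact mul_le_mul_of_nonneg_left h1 (by positivity)
  have h := circleIntegral.norm_two_pi_i_inv_smul_integral_le_of_norm_le_const hr.le hbound
  rw [smul_eq_mul] at h
  calc _ ≤ r * (C₁ * x * L ^ (r - 2) / r ^ (k + 1)) := h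
    _ = C₁ * x * L ^ (r - 2) / r ^ k := by
        rw [pow_succ]; field_simp

/-- **The main integral for `k = 1`**: `(2πi)⁻¹ ∮_{|z|=r} G_x(z) e^{L₂ z} z^{-1} dz = G_x(0) = 1`
(Cauchy's integral formula; `G_x(0) = 1`). [cite: MontgomeryVaughan2007, proof of Theorem 7.19] -/
theorem mainIntegral_one (x : ℕ) (L₂ : ℝ) {r : ℝ} (hr : 0 < r) :
    (2 * Real.pi * I)⁻¹ * ∮ z in C(0, r), satheSelbergGC x z * Complex.exp ((L₂ : ℂ) * z) / z ^ 1 =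
      1 := by
  set H : ℂ → ℂ := fun z => satheSelbergGC x z * Complex.exp ((L₂ : ℂ) * z) with hH
  have hHd : DifferentiableOn ℂ H (closedBall 0 r) :=
    ((differentiable_satheSelbergGC x).mul (by fun_prop)).differentiableOn
  have h := hHd.circleIntegral_sub_inv_smul (mem_ball_self hr)
  have hH0 : H 0 = 1 := by simp [hH]
  rw [hH0] at h
  have hcongr : (∮ z in C(0, r), satheSelbergGC x z * Complex.exp ((L₂ : ℂ) * z) / z ^ 1) =
      ∮ z in C(0, r), (z - 0)⁻¹ • H z := by
    refine circleIntegral.integral_congr hr.le fun z _ => ?_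
    simp only [hH, sub_zero, smul_eq_mul, pow_one]
    ring
  rw [hcongr, h, smul_eq_mul, mul_one, inv_mul_cancel₀ Complex.two_pi_I_ne_zero]

/-- **The main integral for `k ≥ 2`** (Montgomery–Vaughan (7.63)): with `r = (k-1)/L₂`,
`(2πi)⁻¹ ∮_{|z|=r} G(z) e^{L₂ z} z^{-k} dz = G(r) L₂^{k-1}/(k-1)! + (2πi)⁻¹ ∮_{|z|=r} Q(z) e^{L₂ z} z^{-k} dz`,
`Q(z) = G(z) - G(r) - G'(r)(z-r)`: the linear Taylor term integrates to
`G'(r)[L₂^{k-2}/(k-2)! - r L₂^{k-1}/(k-1)!] = 0` at this radius.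
[cite: MontgomeryVaughan2007, (7.63)] -/
theorem mainIntegral_two_le (x : ℕ) {L₂ : ℝ} (hL₂ : 0 < L₂) {k : ℕ} (hk : 2 ≤ k) {r : ℝ}
    (hrdef : r = ((k : ℝ) - 1) / L₂) :
    (2 * Real.pi * I)⁻¹ * ∮ z in C(0, r), satheSelbergGC x z * Complex.exp ((L₂ : ℂ) * z) / z ^ k =
      satheSelbergGC x r * (L₂ : ℂ) ^ (k - 1) / ((k - 1).factorial : ℂ) +
      (2 * Real.pi * I)⁻¹ * ∮ z in C(0, r),
        (satheSelbergGC x z - satheSelbergGC x r - deriv (satheSelbergGC x) r * (z - r)) *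
          Complex.exp ((L₂ : ℂ) * z) / z ^ k := by
  obtain ⟨m, rfl⟩ : ∃ m, k = m + 2 := ⟨k - 2, by omega⟩
  have hr : 0 < r := by
    rw [hrdef]; push_cast
    exact div_pos (by linarith) hL₂
  set G : ℂ → ℂ := satheSelbergGC x with hG
  set e : ℂ → ℂ := fun z => Complex.exp ((L₂ : ℂ) * z) with he
  have hec : Continuous e := by rw [he]; fun_prop
  have hGc : Continuous G := (differentiable_satheSelbergGC x).continuous
  -- the three pieces
  set f₁ : ℂ → ℂ := fun z => G r * e z / z ^ (m + 2) with hf₁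
  set f₂ : ℂ → ℂ := fun z => deriv G r * (e z / z ^ (m + 1) - (r : ℂ) * (e z / z ^ (m + 2)))
    with hf₂
  set f₃ : ℂ → ℂ := fun z => (G z - G r - deriv G r * (z - r)) * e z / z ^ (m + 2) with hf₃
  have hsplit : ∀ z ∈ sphere (0 : ℂ) r, G z * e z / z ^ (m + 2) = f₁ z + f₂ z + f₃ z := by
    intro z hz
    have hz0 := ne_zero_of_mem_sphere_zero hr hz
    simp only [hf₁, hf₂, hf₃]
    have hz1 : z ^ (m + 1) ≠ 0 := pow_ne_zero _ hz0
    have hz2 : z ^ (m + 2) ≠ 0 := pow_ne_zero _ hz0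
    field_simp
    ring
  have hne : ∀ z ∈ sphere (0 : ℂ) r, ∀ j : ℕ, z ^ j ≠ 0 := fun z hz j =>
    pow_ne_zero _ (ne_zero_of_mem_sphere_zero hr hz)
  have hf₁i : CircleIntegrable f₁ 0 r := by
    refine ContinuousOn.circleIntegrable hr.le ?_
    simp only [hf₁]
    exact ContinuousOn.div (by fun_prop) (by fun_prop) fun z hz => hne z hz _
  have hf₂i : CircleIntegrable f₂ 0 r := by
    refine ContinuousOn.circleIntegrable hr.le ?_
    simp only [hf₂]
    refine ContinuousOn.mul continuousOn_const (ContinuousOn.sub ?_ (ContinuousOn.mul continuousOn_const ?_))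
    · exact ContinuousOn.div hec.continuousOn (by fun_prop) fun z hz => hne z hz _
    · exact ContinuousOn.div hec.continuousOn (by fun_prop) fun z hz => hne z hz _
  have hf₃i : CircleIntegrable f₃ 0 r := by
    refine ContinuousOn.circleIntegrable hr.le ?_
    simp only [hf₃]
    refine ContinuousOn.div ?_ (by fun_prop) fun z hz => hne z hz _
    exact (((hGc.sub continuous_const).sub (continuous_const.mul (by fun_prop))).mul hec).continuousOn
  -- evaluate the first two
  have hI₁ : (∮ z in C(0, r), f₁ z) =
      2 * Real.pi * I / ((m + 2 - 1).factorial : ℕ) * (L₂ : ℂ) ^ (m + 2 - 1) * G r := by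
    simp only [hf₁, he]
    exact circleIntegral_const_mul_exp_mul_div_pow (G r) (L₂ : ℂ) (k := m + 2) (by omega) hr
  have hI₂ : (∮ z in C(0, r), f₂ z) = 0 := by
    simp only [hf₂, he]
    have hi1 : CircleIntegrable (fun z => Complex.exp ((L₂ : ℂ) * z) / z ^ (m + 1)) 0 r :=
      ContinuousOn.circleIntegrable hr.le
        (ContinuousOn.div (by fun_prop) (by fun_prop) fun z hz => hne z hz _)
    have hi2 : CircleIntegrable (fun z => (r : ℂ) * (Complex.exp ((L₂ : ℂ) * z) / z ^ (m + 2))) 0 r :=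
      (ContinuousOn.circleIntegrable hr.le
        (ContinuousOn.div (by fun_prop) (by fun_prop) fun z hz => hne z hz _)).const_smul (a := (r : ℂ))
    rw [circleIntegral.integral_const_mul, circleIntegral.integral_sub hi1 hi2,
      circleIntegral.integral_const_mul, circleIntegral_exp_mul_div_pow_succ _ m hr,
      circleIntegral_exp_mul_div_pow_succ _ (m + 1) hr]
    -- `L₂^m/m! - r L₂^{m+1}/(m+1)! = 0` for `r = (m+1)/L₂`
    have hL₂c : (L₂ : ℂ) ≠ 0 := by exact_mod_cast hL₂.ne'
    have hfac : ((m + 1).factorial : ℂ) = (m + 1 : ℂ) * (m.factorial : ℂ) := by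
      rw [Nat.factorial_succ]; push_cast; ring
    have hrc : (r : ℂ) = ((m : ℂ) + 1) / (L₂ : ℂ) := by
      rw [hrdef]; push_cast; ring
    rw [hrc, hfac]
    have hm0 : (m.factorial : ℂ) ≠ 0 := by exact_mod_cast (Nat.factorial_pos m).ne'
    have hm1 : ((m : ℂ) + 1) ≠ 0 := by exact_mod_cast Nat.succ_ne_zero m
    field_simp
    ring
  -- assemble
  have hint : (∮ z in C(0, r), G z * e z / z ^ (m + 2)) =
      (∮ z in C(0, r), f₁ z) + (∮ z in C(0, r), f₂ z) + ∮ z in C(0, r), f₃ z := by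
    have h12 : CircleIntegrable (fun z => f₁ z + f₂ z) 0 r := hf₁i.add hf₂i
    calc (∮ z in C(0, r), G z * e z / z ^ (m + 2)) = ∮ z in C(0, r), ((f₁ z + f₂ z) + f₃ z) :=
          circleIntegral.integral_congr hr.le fun z hz => hsplit z hz
      _ = (∮ z in C(0, r), (f₁ z + f₂ z)) + ∮ z in C(0, r), f₃ z :=
          circleIntegral.integral_add h12 hf₃i
      _ = _ := by rw [circleIntegral.integral_add hf₁i hf₂i]
  change (2 * Real.pi * I)⁻¹ * (∮ z in C(0, r), G z * e z / z ^ (m + 2)) =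
    G r * (L₂ : ℂ) ^ (m + 2 - 1) / ((m + 2 - 1).factorial : ℂ) +
      (2 * Real.pi * I)⁻¹ * ∮ z in C(0, r), f₃ z
  rw [hint, hI₁, hI₂, add_zero, mul_add]
  congr 1
  have h2pi : (2 * Real.pi * I : ℂ) ≠ 0 := Complex.two_pi_I_ne_zero
  have hf : ((m + 2 - 1).factorial : ℂ) ≠ 0 := by exact_mod_cast (Nat.factorial_pos _).ne'
  field_simp

/-- **The Taylor remainder integral** (Montgomery–Vaughan p. 180): with `r = n/L₂`, `n = k - 1 ≥ 1`,
`|G_x| ≤ M` on `|w| ≤ R + 1` and `r ≤ R`,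
`|∮_{|z|=r} Q(z) e^{L₂ z} z^{-k} dz| ≤ 2M r³ r^{-k} ∫_0^{2π} |e^{iθ}-1|² e^{n cos θ} dθ ≤ 2M r³ r^{-k} · C_F eⁿ n^{-3/2}`
("`≪ r^{3-k} ∫ (sin πθ)² e^{(k-1)cos 2πθ} dθ ≪ r^{3-k} e^{k-1} (k-1)^{-3/2}`").
[cite: MontgomeryVaughan2007, proof of Theorem 7.19] -/
theorem norm_remainderIntegral_le (x : ℕ) {R M B L₂ r : ℝ} {n : ℕ} (hM : 0 ≤ M) (hr : 0 < r)
    (hrR : r ≤ R) (hrn : r * L₂ = n)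
    (hGM : ∀ w : ℂ, ‖w‖ ≤ R + 1 → ‖satheSelbergGC x w‖ ≤ M)
    (hB : ∫ θ in (0 : ℝ)..2 * Real.pi, ‖Complex.exp (θ * I) - 1‖ ^ 2 * Real.exp (n * Real.cos θ) ≤ B)
    (k : ℕ) :
    ‖∮ z in C(0, r), (satheSelbergGC x z - satheSelbergGC x r -
        deriv (satheSelbergGC x) r * (z - r)) * Complex.exp ((L₂ : ℂ) * z) / z ^ k‖ ≤
      2 * M * r ^ 3 * (r ^ k)⁻¹ * B := by
  set G : ℂ → ℂ := satheSelbergGC x with hG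
  have hGd : Differentiable ℂ G := differentiable_satheSelbergGC x
  set g : ℝ → ℝ := fun θ => 2 * M * r ^ 3 * (r ^ k)⁻¹ *
    (‖Complex.exp (θ * I) - 1‖ ^ 2 * Real.exp (n * Real.cos θ)) with hg
  have hgc : Continuous g := by rw [hg]; fun_prop
  -- pointwise bound of the parametrised integrand
  have hpt : ∀ θ : ℝ, ‖deriv (circleMap 0 r) θ •
      ((fun z => (G z - G r - deriv G r * (z - r)) * Complex.exp ((L₂ : ℂ) * z) / z ^ k)
        (circleMap 0 r θ))‖ ≤ g θ := by
    intro θ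
    set z : ℂ := circleMap 0 r θ with hz
    have hzn : ‖z‖ = r := by rw [hz, norm_circleMap_zero, abs_of_pos hr]
    have hderiv : ‖deriv (circleMap 0 r) θ‖ = r := by
      rw [deriv_circleMap, norm_mul, norm_circleMap_zero, Complex.norm_I, mul_one, abs_of_pos hr]
    have hzr : z - r = r * (Complex.exp (θ * I) - 1) := by
      rw [hz, circleMap]; ring
    have hQ : ‖G z - G r - deriv G r * (z - r)‖ ≤ 2 * M * (r ^ 2 * ‖Complex.exp (θ * I) - 1‖ ^ 2) := by
      have h := norm_taylor_two_remainder_le hGd (ρ := R) hGM (a := (r : ℂ)) (z := z)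
        (by rw [Complex.norm_real, Real.norm_eq_abs, abs_of_pos hr]; exact hrR) (by rw [hzn]; exact hrR)
      have hn2 : ‖z - r‖ ^ 2 = r ^ 2 * ‖Complex.exp (θ * I) - 1‖ ^ 2 := by
        rw [hzr, norm_mul, Complex.norm_real, Real.norm_eq_abs, abs_of_pos hr, mul_pow]
      rw [hn2] at h
      exact h
    have hexp : ‖Complex.exp ((L₂ : ℂ) * z)‖ = Real.exp (n * Real.cos θ) := by
      rw [Complex.norm_exp]
      congr 1
      have : ((L₂ : ℂ) * z).re = L₂ * z.re := by simp [Complex.mul_re]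
      rw [this, hz, circleMap, zero_add, Complex.re_ofReal_mul, Complex.exp_ofReal_mul_I_re,
        ← mul_assoc, mul_comm L₂ r, hrn]
    rw [norm_smul, hderiv, norm_div, norm_mul, norm_pow, hzn, hexp]
    simp only [hg]
    have hrk : 0 < r ^ k := pow_pos hr k
    rw [div_eq_mul_inv]
    have h1 : 0 ≤ Real.exp (n * Real.cos θ) := (Real.exp_pos _).le
    calc r * (‖G z - G ↑r - deriv G ↑r * (z - ↑r)‖ * Real.exp (n * Real.cos θ) * (r ^ k)⁻¹)
        ≤ r * (2 * M * (r ^ 2 * ‖Complex.exp (θ * I) - 1‖ ^ 2) * Real.exp (n * Real.cos θ) *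
            (r ^ k)⁻¹) := by gcongr
      _ = _ := by ring
  -- integrate
  rw [circleIntegral]
  calc ‖∫ θ in (0 : ℝ)..2 * Real.pi, deriv (circleMap 0 r) θ •
        (fun z => (G z - G ↑r - deriv G ↑r * (z - ↑r)) * Complex.exp (↑L₂ * z) / z ^ k)
          (circleMap 0 r θ)‖
      ≤ ∫ θ in (0 : ℝ)..2 * Real.pi, g θ :=
        intervalIntegral.norm_integral_le_of_norm_le Real.two_pi_pos.le
          (Filter.Eventually.of_forall fun θ _ => hpt θ) (hgc.intervalIntegrable _ _)
    _ = 2 * M * r ^ 3 * (r ^ k)⁻¹ *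
          ∫ θ in (0 : ℝ)..2 * Real.pi, ‖Complex.exp (θ * I) - 1‖ ^ 2 * Real.exp (n * Real.cos θ) := by
        rw [hg, intervalIntegral.integral_const_mul]
    _ ≤ 2 * M * r ^ 3 * (r ^ k)⁻¹ * B := by
        have : 0 ≤ 2 * M * r ^ 3 * (r ^ k)⁻¹ := by positivity
        exact mul_le_mul_of_nonneg_left hB this

/-! ### Two numerical inequalities (Stirling) -/

/-- (N1) With `r = n/L₂`, `n ≥ 1`:
`r³ r^{-(n+1)} eⁿ n^{-3/2} · n! ≤ e · n · L₂ⁿ / L₂²`. [folklore] -/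
theorem numeric_ineq_one {n : ℕ} (hn : 1 ≤ n) {L₂ r : ℝ} (hL₂ : 0 < L₂) (hr : r = n / L₂) :
    r ^ 3 * (r ^ (n + 1))⁻¹ * (Real.exp n * (n : ℝ) ^ (-(3 : ℝ) / 2)) * n.factorial ≤
      Real.exp 1 * n * L₂ ^ n / L₂ ^ 2 := by
  have hn0 : (0 : ℝ) < n := by exact_mod_cast hn
  have hsq : 0 < Real.sqrt n := Real.sqrt_pos.2 hn0
  have hrpos : 0 < r := by rw [hr]; positivity
  -- `n^{-3/2} = (n √n)⁻¹`
  have hpow : (n : ℝ) ^ (-(3 : ℝ) / 2) = ((n : ℝ) * Real.sqrt n)⁻¹ := by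
    rw [show (-(3 : ℝ) / 2) = -((1 : ℝ) + 1 / 2) by norm_num, Real.rpow_neg hn0.le,
      Real.rpow_add hn0, Real.rpow_one, Real.sqrt_eq_rpow]
  have hst := factorial_mul_exp_le hn
  rw [hpow, hr]
  rw [div_pow, div_pow]
  have key : ((n : ℝ) ^ 3 / L₂ ^ 3) * ((n : ℝ) ^ (n + 1) / L₂ ^ (n + 1))⁻¹ *
      (Real.exp n * ((n : ℝ) * Real.sqrt n)⁻¹) * n.factorial =
      ((n : ℝ) ^ 3 * L₂ ^ (n + 1) * ((n.factorial : ℝ) * Real.exp n)) /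
        (L₂ ^ 3 * (n : ℝ) ^ (n + 1) * ((n : ℝ) * Real.sqrt n)) := by
    field_simp
  rw [key, div_le_div_iff₀ (by positivity) (by positivity)]
  calc (n : ℝ) ^ 3 * L₂ ^ (n + 1) * ((n.factorial : ℝ) * Real.exp n) * L₂ ^ 2
      ≤ (n : ℝ) ^ 3 * L₂ ^ (n + 1) * (Real.exp 1 * Real.sqrt n * (n : ℝ) ^ n) * L₂ ^ 2 := by
        gcongr
    _ = Real.exp 1 * n * L₂ ^ n * (L₂ ^ 3 * (n : ℝ) ^ (n + 1) * ((n : ℝ) * Real.sqrt n)) := by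
        ring

/-- (N2) With `r = n/L₂`, `L₂ = log L`, `L ≥ 1`, `n ≥ 1`:
`L^{r-2} r^{-(n+1)} · n! ≤ e L₂^{n+1}/L²`. [folklore] -/
theorem numeric_ineq_two {n : ℕ} (hn : 1 ≤ n) {L L₂ r : ℝ} (hL : 1 ≤ L) (hL₂ : L₂ = Real.log L)
    (hL₂pos : 0 < L₂) (hr : r = n / L₂) :
    L ^ (r - 2) / r ^ (n + 1) * n.factorial ≤ Real.exp 1 * L₂ ^ (n + 1) / L ^ 2 := by
  have hn0 : (0 : ℝ) < n := by exact_mod_cast hn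
  have hL0 : 0 < L := by linarith
  have hrpos : 0 < r := by rw [hr]; positivity
  -- `L^{r-2} = eⁿ / L²`
  have hLr : L ^ (r - 2) = Real.exp n / L ^ 2 := by
    rw [Real.rpow_sub hL0, Real.rpow_two, Real.rpow_def_of_pos hL0, ← hL₂, hr]
    congr 2
    field_simp
  have hst := factorial_mul_exp_le hn
  have hn1 : (1 : ℝ) ≤ n := by exact_mod_cast hn
  have hsqrt : Real.sqrt n ≤ n := by
    rw [Real.sqrt_le_left hn0.le]
    nlinarith
  rw [hLr, hr, div_pow]
  have key : Real.exp n / L ^ 2 / ((n : ℝ) ^ (n + 1) / L₂ ^ (n + 1)) * n.factorial =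
      L₂ ^ (n + 1) * ((n.factorial : ℝ) * Real.exp n) / (L ^ 2 * (n : ℝ) ^ (n + 1)) := by
    field_simp
  rw [key, div_le_div_iff₀ (by positivity) (by positivity)]
  calc L₂ ^ (n + 1) * ((n.factorial : ℝ) * Real.exp n) * L ^ 2
      ≤ L₂ ^ (n + 1) * (Real.exp 1 * Real.sqrt n * (n : ℝ) ^ n) * L ^ 2 := by gcongr
    _ ≤ L₂ ^ (n + 1) * (Real.exp 1 * n * (n : ℝ) ^ n) * L ^ 2 := by gcongr
    _ = Real.exp 1 * L₂ ^ (n + 1) * (L ^ 2 * (n : ℝ) ^ (n + 1)) := by ring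

/-! ### The two cases `k = 1` and `k ≥ 2` -/

/-- **Case `k = 1`** (Montgomery–Vaughan take this from the prime number theorem; here it also
follows from the mean value, on the circle `|z| = 1/log log x`, where Cauchy's formula gives the
main term `G(0) = 1` exactly): `|ρ₁(x) - x/log x| ≤ C₁ e (log log x)³/log x · (x/log x)/(log log x)²`.
[cite: MontgomeryVaughan2007, proof of Theorem 7.19] -/
theorem abs_sub_le_case_one (x : ℕ) (hx2 : 2 ≤ x) {R C₁ : ℝ} (hC₁ : 0 ≤ C₁)
    (hL1 : 1 ≤ Real.log x) (hL₂0 : 0 < Real.log (Real.log x))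
    (hL₂R : 1 / Real.log (Real.log x) ≤ R)
    (hE : ∀ z : ℂ, ‖z‖ ≤ R →
      ‖(∑ n ∈ Finset.Icc 1 x, z ^ (ArithmeticFunction.cardDistinctFactors n)) -
          satheSelbergFC x z / Complex.Gamma z * (x : ℂ) * ((Real.log x : ℂ) ^ (z - 1))‖ ≤
        C₁ * x * Real.log x ^ (z.re - 2)) :
    |(distinctPrimeFactorCount x 1 : ℝ) - x / Real.log x| ≤
      C₁ * Real.exp 1 * Real.log (Real.log x) ^ 3 / Real.log x *
        ((x / Real.log x) * (1 / Real.log (Real.log x) ^ 2)) := by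
  set L : ℝ := Real.log x with hLdef
  set L₂ : ℝ := Real.log L with hL₂def
  have hL0 : 0 < L := by linarith
  have hxpos : (0 : ℝ) < x := by exact_mod_cast (by omega : 0 < x)
  set r : ℝ := 1 / L₂ with hrdef
  have hr : 0 < r := by positivity
  have hsplit := distinctPrimeFactorCount_eq_main_add_error x hx2 hr 1
  rw [mainIntegral_one x _ hr, mul_one, ← hLdef] at hsplit
  have herr := norm_errorIntegral_le (E := fun z : ℂ =>
      (∑ n ∈ Finset.Icc 1 x, z ^ (ArithmeticFunction.cardDistinctFactors n)) -
        satheSelbergFC x z / Complex.Gamma z * (x : ℂ) * ((L : ℂ) ^ (z - 1)))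
    hC₁ hxpos.le hL1 hr hL₂R hE 1
  -- `L^{r-2} = e/L²`
  have hLr : L ^ (r - 2) = Real.exp 1 / L ^ 2 := by
    rw [Real.rpow_sub hL0, Real.rpow_two, Real.rpow_def_of_pos hL0, ← hL₂def, hrdef]
    congr 2
    field_simp
  rw [hLr, pow_one] at herr
  -- the difference is exactly the error integral
  have hdiff : (((distinctPrimeFactorCount x 1 : ℝ) - x / L : ℝ) : ℂ) =
      (2 * Real.pi * I)⁻¹ * ∮ z in C(0, r),
        ((∑ n ∈ Finset.Icc 1 x, z ^ (ArithmeticFunction.cardDistinctFactors n)) -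
          satheSelbergFC x z / Complex.Gamma z * (x : ℂ) * ((L : ℂ) ^ (z - 1))) / z ^ (1 + 1) := by
    push_cast
    rw [hsplit]
    ring
  rw [← Real.norm_eq_abs, ← Complex.norm_real, hdiff]
  refine herr.trans (le_of_eq ?_)
  rw [hrdef]
  field_simp

/-- **Case `k ≥ 2`** (Montgomery–Vaughan p. 180, the heart of the proof of Theorem 7.19): on the
circle `|z| = r = (k-1)/log log x`, the main integral is `G(r)(log log x)^{k-1}/(k-1)!` plus the
Taylor-remainder integral `≪ M r^{3-k} e^{k-1}(k-1)^{-3/2}`, and the error integral is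
`≪ C₁ x (log x)^{r-2} r^{-k}`; by Stirling both are `≪ (main term) · k/(log log x)²`, the second
with the extra factor `(log log x)³/log x`. [cite: MontgomeryVaughan2007, proof of Theorem 7.19] -/
theorem abs_sub_le_case_two_le (x : ℕ) (hx2 : 2 ≤ x) {R C₁ M c₀ C_F : ℝ}
    (hC₁ : 0 ≤ C₁) (hM : 0 < M) (hc₀ : 0 < c₀) (hCF : 0 < C_F)
    (hL1 : 1 ≤ Real.log x) (hL₂1 : 1 ≤ Real.log (Real.log x))
    (hE : ∀ z : ℂ, ‖z‖ ≤ R →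
      ‖(∑ n ∈ Finset.Icc 1 x, z ^ (ArithmeticFunction.cardDistinctFactors n)) -
          satheSelbergFC x z / Complex.Gamma z * (x : ℂ) * ((Real.log x : ℂ) ^ (z - 1))‖ ≤
        C₁ * x * Real.log x ^ (z.re - 2))
    (hGM : ∀ w : ℂ, ‖w‖ ≤ R + 1 → ‖satheSelbergGC x w‖ ≤ M)
    (hGc : ∀ r : ℝ, 0 ≤ r → r ≤ R → c₀ ≤ satheSelbergG x r)
    (hCFb : ∀ κ : ℝ, 1 ≤ κ →
      ∫ θ in (0 : ℝ)..2 * Real.pi, ‖Complex.exp (θ * I) - 1‖ ^ 2 * Real.exp (κ * Real.cos θ) ≤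
        C_F * Real.exp κ * κ ^ (-(3 : ℝ) / 2))
    {k : ℕ} (hk : 2 ≤ k) (hkR : (k : ℝ) ≤ R * Real.log (Real.log x)) :
    |(distinctPrimeFactorCount x k : ℝ) -
        satheSelbergG x (((k : ℝ) - 1) / Real.log (Real.log x)) *
          ((x : ℝ) * Real.log (Real.log x) ^ (k - 1) / (((k - 1).factorial : ℝ) * Real.log x))| ≤
      (Real.exp 1 * M * C_F / (Real.pi * c₀) +
          C₁ * Real.exp 1 * Real.log (Real.log x) ^ 3 / (c₀ * Real.log x)) *
        (satheSelbergG x (((k : ℝ) - 1) / Real.log (Real.log x)) *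
          ((x : ℝ) * Real.log (Real.log x) ^ (k - 1) / (((k - 1).factorial : ℝ) * Real.log x))) *
        ((k : ℝ) / Real.log (Real.log x) ^ 2) := by
  obtain ⟨n, rfl⟩ : ∃ n, k = n + 1 := ⟨k - 1, by omega⟩
  have hn : 1 ≤ n := by omega
  have hn0 : (0 : ℝ) < n := by exact_mod_cast hn
  simp only [Nat.add_sub_cancel]
  have hcast : ((n + 1 : ℕ) : ℝ) - 1 = n := by push_cast; ring
  rw [hcast]
  set L : ℝ := Real.log x with hLdef
  set L₂ : ℝ := Real.log L with hL₂def
  have hL0 : 0 < L := by linarith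
  have hL₂0 : 0 < L₂ := by linarith
  have hxpos : (0 : ℝ) < x := by exact_mod_cast (by omega : 0 < x)
  set r : ℝ := (n : ℝ) / L₂ with hrdef
  have hr : 0 < r := by positivity
  have hrn : r * L₂ = n := by rw [hrdef]; field_simp
  have hrR : r ≤ R := by
    rw [hrdef, div_le_iff₀ hL₂0]
    have : ((n + 1 : ℕ) : ℝ) = n + 1 := by push_cast; ring
    rw [this] at hkR
    nlinarith
  set g : ℝ := satheSelbergG x r with hgdef
  have hg : c₀ ≤ g := hGc r hr.le hrR
  have hgpos : 0 < g := hc₀.trans_le hg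
  -- the three analytic inputs
  have hsplit := distinctPrimeFactorCount_eq_main_add_error x hx2 hr (n + 1)
  rw [← hLdef, ← hL₂def] at hsplit
  have hmain := mainIntegral_two_le x hL₂0 (k := n + 1) (by omega) (r := r)
    (by rw [hrdef]; push_cast; ring)
  simp only [Nat.add_sub_cancel] at hmain
  set I₃ : ℂ := ∮ z in C(0, r), (satheSelbergGC x z - satheSelbergGC x r -
      deriv (satheSelbergGC x) r * (z - r)) * Complex.exp ((L₂ : ℂ) * z) / z ^ (n + 1) with hI₃def
  have hI₃ := norm_remainderIntegral_le x hM.le hr hrR hrn hGM (hCFb n (by exact_mod_cast hn)) (n + 1)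
  rw [← hI₃def] at hI₃
  set Err : ℂ := (2 * Real.pi * I)⁻¹ * ∮ z in C(0, r),
      ((∑ i ∈ Finset.Icc 1 x, z ^ (ArithmeticFunction.cardDistinctFactors i)) -
        satheSelbergFC x z / Complex.Gamma z * (x : ℂ) * ((L : ℂ) ^ (z - 1))) / z ^ (n + 1 + 1)
    with hErrdef
  have herr := norm_errorIntegral_le (E := fun z : ℂ =>
      (∑ i ∈ Finset.Icc 1 x, z ^ (ArithmeticFunction.cardDistinctFactors i)) -
        satheSelbergFC x z / Complex.Gamma z * (x : ℂ) * ((L : ℂ) ^ (z - 1)))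
    hC₁ hxpos.le hL1 hr hrR hE (n + 1)
  rw [← hErrdef] at herr
  -- the difference `ρ_k - main term` in `ℂ`
  have hGr : satheSelbergGC x r = (g : ℂ) := by rw [hgdef, satheSelbergGC_ofReal]
  have hdiff : (((distinctPrimeFactorCount x (n + 1) : ℝ) -
        g * ((x : ℝ) * L₂ ^ n / ((n.factorial : ℝ) * L)) : ℝ) : ℂ) =
      (x : ℂ) / (L : ℂ) * ((2 * Real.pi * I)⁻¹ * I₃) + Err := by
    have hLc : (L : ℂ) ≠ 0 := by exact_mod_cast hL0.ne'
    have hfc : (n.factorial : ℂ) ≠ 0 := by exact_mod_cast (Nat.factorial_pos n).ne'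
    push_cast
    rw [hsplit, hmain, hGr]
    field_simp
    ring
  rw [← Real.norm_eq_abs, ← Complex.norm_real, hdiff]
  -- norm bounds of the two terms
  have hxL : ‖(x : ℂ) / (L : ℂ)‖ = x / L := by
    rw [norm_div, Complex.norm_natCast, Complex.norm_real, Real.norm_eq_abs, abs_of_pos hL0]
  have h2pi : ‖(2 * Real.pi * I : ℂ)⁻¹‖ = (2 * Real.pi)⁻¹ := by
    simp [Real.pi_pos.le]
  have hT1 : ‖(x : ℂ) / (L : ℂ) * ((2 * Real.pi * I)⁻¹ * I₃)‖ ≤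
      x / L * ((2 * Real.pi)⁻¹ * (2 * M * r ^ 3 * (r ^ (n + 1))⁻¹ *
        (C_F * Real.exp n * (n : ℝ) ^ (-(3 : ℝ) / 2)))) := by
    rw [norm_mul, norm_mul, hxL, h2pi]
    gcongr
  -- Stirling
  have hN1 := numeric_ineq_one hn hL₂0 hrdef
  have hN2 := numeric_ineq_two hn hL1 hL₂def hL₂0 hrdef
  have hfpos : (0 : ℝ) < n.factorial := by exact_mod_cast Nat.factorial_pos n
  -- common positive factor `P = x L₂ⁿ/(n! L L₂²)`
  set P : ℝ := x * L₂ ^ n / ((n.factorial : ℝ) * L * L₂ ^ 2) with hPdef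
  have hPpos : 0 < P := by positivity
  have hRHS : (Real.exp 1 * M * C_F / (Real.pi * c₀) + C₁ * Real.exp 1 * L₂ ^ 3 / (c₀ * L)) *
      (g * ((x : ℝ) * L₂ ^ n / ((n.factorial : ℝ) * L))) * (((n + 1 : ℕ) : ℝ) / L₂ ^ 2) =
      (Real.exp 1 * M * C_F / (Real.pi * c₀)) * (g * (n + 1) * P) +
        (C₁ * Real.exp 1 * L₂ ^ 3 / (c₀ * L)) * (g * (n + 1) * P) := by
    push_cast
    rw [hPdef]
    field_simp
  rw [hRHS]
  refine (norm_add_le _ _).trans (add_le_add ?_ ?_)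
  · -- the Taylor remainder term
    refine hT1.trans ?_
    have h1 : x / L * ((2 * Real.pi)⁻¹ * (2 * M * r ^ 3 * (r ^ (n + 1))⁻¹ *
        (C_F * Real.exp n * (n : ℝ) ^ (-(3 : ℝ) / 2)))) =
        (M * C_F / Real.pi) * (x / L) *
          (r ^ 3 * (r ^ (n + 1))⁻¹ * (Real.exp n * (n : ℝ) ^ (-(3 : ℝ) / 2))) := by
      field_simp
    rw [h1]
    have h2 : r ^ 3 * (r ^ (n + 1))⁻¹ * (Real.exp n * (n : ℝ) ^ (-(3 : ℝ) / 2)) ≤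
        Real.exp 1 * n * L₂ ^ n / L₂ ^ 2 / n.factorial := by
      rw [le_div_iff₀ hfpos]; exact hN1
    calc M * C_F / Real.pi * (x / L) * (r ^ 3 * (r ^ (n + 1))⁻¹ * (Real.exp n * (n : ℝ) ^ (-(3 : ℝ) / 2)))
        ≤ M * C_F / Real.pi * (x / L) * (Real.exp 1 * n * L₂ ^ n / L₂ ^ 2 / n.factorial) := by
          gcongr
      _ = Real.exp 1 * M * C_F / (Real.pi * c₀) * (c₀ * n * P) := by
          rw [hPdef]; field_simp
      _ ≤ Real.exp 1 * M * C_F / (Real.pi * c₀) * (g * (n + 1) * P) := by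
          gcongr; linarith [hg]
  · -- the error term
    refine herr.trans ?_
    have h2 : L ^ (r - 2) / r ^ (n + 1) ≤ Real.exp 1 * L₂ ^ (n + 1) / L ^ 2 / n.factorial := by
      rw [le_div_iff₀ hfpos]; exact hN2
    calc C₁ * x * L ^ (r - 2) / r ^ (n + 1) = C₁ * x * (L ^ (r - 2) / r ^ (n + 1)) := by ring
      _ ≤ C₁ * x * (Real.exp 1 * L₂ ^ (n + 1) / L ^ 2 / n.factorial) := by gcongr
      _ = C₁ * Real.exp 1 * L₂ ^ 3 / (c₀ * L) * (c₀ * 1 * P) := by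
          rw [hPdef]; field_simp; ring
      _ ≤ C₁ * Real.exp 1 * L₂ ^ 3 / (c₀ * L) * (g * (n + 1) * P) := by
          gcongr; linarith [hg]

end SatheSelberg

/-! ### The theorem -/

open SatheSelberg in
/-- **The Sathe–Selberg formula for `ω` from Selberg's mean value formula for `z^{ω(n)}`**
(Montgomery–Vaughan 2007, §7.4.1 Exercise 3(c) via the proof of Theorem 7.19, p. 180): IF for
every `R > 0` there is `C` with
`|∑_{n ≤ x} z^{ω(n)} - F_x(z)/Γ(z) · x (log x)^{z-1}| ≤ C x (log x)^{Re z - 2}` for all `x ≥ 2`,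
`|z| ≤ R` (Montgomery–Vaughan Theorem 7.18 with the Euler product of Exercise 3(a)–(b), for which
`a_z(n) = z^{ω(n)}`; Selberg 1954 — the Selberg–Delange input, NOT proved here), THEN
`MontgomeryVaughan2007_exercise_7_4_3c` holds: `ρ_k(x) = G_x((k-1)/log log x) x (log log x)^{k-1}
/((k-1)! log x) · (1 + O_R(k/(log log x)²))` uniformly for `1 ≤ k ≤ R log log x`, `x ≥ x₀(R)`.
The proof is Montgomery–Vaughan's: Cauchy's formula (7.61) on `|z| = r = (k-1)/log log x`, the
decomposition (7.63) `G(z) = G(r) + G'(r)(z-r) + O(|z-r|²)` whose linear term integrates to zero,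
the bound `∫ (sin πθ)² e^{(k-1)cos 2πθ} dθ ≪ e^{k-1}(k-1)^{-3/2}`, and Stirling's formula; the
case `k = 1` is read off the same mean value on `|z| = 1/log log x` (instead of the prime
number theorem). [cite: MontgomeryVaughan2007, §7.4.1 Exercise 3(c); proof of Theorem 7.19] -/
theorem MontgomeryVaughan2007_exercise_7_4_3c_of_omegaMeanValue
    (hmv : ∀ R : ℝ, 0 < R → ∃ C : ℝ, ∀ x : ℕ, 2 ≤ x → ∀ z : ℂ, ‖z‖ ≤ R →
      ‖(∑ n ∈ Finset.Icc 1 x, z ^ (ArithmeticFunction.cardDistinctFactors n)) -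
          satheSelbergFC x z / Complex.Gamma z * (x : ℂ) * ((Real.log x : ℂ) ^ (z - 1))‖ ≤
        C * (x : ℝ) * Real.log x ^ (z.re - 2)) :
    MontgomeryVaughan2007_exercise_7_4_3c := by
  intro R hR
  obtain ⟨C₁, hC₁⟩ := hmv R hR
  set C₁' : ℝ := max C₁ 1 with hC₁'
  have hC₁'pos : 0 < C₁' := lt_max_of_lt_right one_pos
  obtain ⟨M, hM, hGM⟩ := exists_bound_satheSelbergGC (R + 1) (by linarith)
  obtain ⟨c₀, hc₀, hGc⟩ := exists_pos_le_satheSelbergG R hR.le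
  obtain ⟨C_F, hCF, hCFb⟩ := exists_bound_angular_integral
  have hc₀1 : c₀ ≤ 1 := by simpa using hGc 0 0 le_rfl hR.le
  set C : ℝ := Real.exp 1 * M * C_F / (Real.pi * c₀) + 1 with hCdef
  have hC0 : 0 ≤ Real.exp 1 * M * C_F / (Real.pi * c₀) := by positivity
  have hC1 : 1 ≤ C := by linarith
  -- thresholds in `x`
  have hev : ∀ᶠ x : ℕ in atTop, 2 ≤ x ∧ 1 ≤ Real.log x ∧ max 1 (1 / R) ≤ Real.log (Real.log x) ∧
      (C₁' * Real.exp 1 / c₀) * Real.log (Real.log x) ^ 3 ≤ Real.log x := by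
    refine (eventually_ge_atTop 2).and ((((Real.tendsto_log_atTop.comp
      tendsto_natCast_atTop_atTop).eventually_ge_atTop 1)).and
        (((Real.tendsto_log_atTop.comp (Real.tendsto_log_atTop.comp
          tendsto_natCast_atTop_atTop)).eventually_ge_atTop _).and
          (eventually_mul_log_log_pow_three_le_log _)))
  obtain ⟨x₀, hx₀⟩ := Filter.eventually_atTop.1 hev
  refine ⟨C, x₀, fun x hx k hk hkR => ?_⟩
  obtain ⟨hx2, hL1, hL₂', hthr⟩ := hx₀ x hx
  have hL0 : 0 < Real.log x := by linarith
  have hL₂1 : 1 ≤ Real.log (Real.log x) := le_of_max_le_left hL₂'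
  have hL₂R : 1 / R ≤ Real.log (Real.log x) := le_of_max_le_right hL₂'
  have hL₂0 : 0 < Real.log (Real.log x) := by linarith
  have hxpos : (0 : ℝ) < x := by exact_mod_cast (by omega : 0 < x)
  -- the mean value error with the constant `C₁' ≥ C₁, C₁' > 0`
  have hE : ∀ z : ℂ, ‖z‖ ≤ R →
      ‖(∑ n ∈ Finset.Icc 1 x, z ^ (ArithmeticFunction.cardDistinctFactors n)) -
          satheSelbergFC x z / Complex.Gamma z * (x : ℂ) * ((Real.log x : ℂ) ^ (z - 1))‖ ≤
        C₁' * x * Real.log x ^ (z.re - 2) := by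
    intro z hz
    refine (hC₁ x hx2 z hz).trans ?_
    gcongr
    exact le_max_left _ _
  -- `C₁' e (log log x)³ / (c₀ log x) ≤ 1`
  have hthr' : C₁' * Real.exp 1 * Real.log (Real.log x) ^ 3 / (c₀ * Real.log x) ≤ 1 := by
    rw [div_le_one (by positivity)]
    have e1 : C₁' * Real.exp 1 * Real.log (Real.log x) ^ 3 =
        c₀ * (C₁' * Real.exp 1 / c₀ * Real.log (Real.log x) ^ 3) := by
      field_simp
    rw [e1]
    exact mul_le_mul_of_nonneg_left hthr hc₀.le
  rcases eq_or_lt_of_le hk with hk1 | hk2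
  · -- `k = 1`
    subst hk1
    have h1R : 1 / Real.log (Real.log x) ≤ R := by
      rw [div_le_iff₀ hL₂0]; rw [div_le_iff₀ hR] at hL₂R; linarith
    have h := abs_sub_le_case_one x hx2 hC₁'pos.le hL1 hL₂0 h1R hE
    have hmain : satheSelbergG x ((((1 : ℕ) : ℝ) - 1) / Real.log (Real.log x)) *
        ((x : ℝ) * Real.log (Real.log x) ^ (1 - 1) / (((1 - 1).factorial : ℝ) * Real.log x)) =
        x / Real.log x := by
      simp
    rw [hmain]
    refine h.trans ?_
    have hcoef : C₁' * Real.exp 1 * Real.log (Real.log x) ^ 3 / Real.log x ≤ C := by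
      have : C₁' * Real.exp 1 * Real.log (Real.log x) ^ 3 / Real.log x ≤ c₀ := by
        rw [div_le_iff₀ hL0]
        have := hthr
        have e : C₁' * Real.exp 1 / c₀ * Real.log (Real.log x) ^ 3 =
            (C₁' * Real.exp 1 * Real.log (Real.log x) ^ 3) / c₀ := by ring
        rw [e, div_le_iff₀ hc₀] at this
        linarith
      linarith
    have hpos : 0 ≤ (x : ℝ) / Real.log x * (1 / Real.log (Real.log x) ^ 2) := by positivity
    calc C₁' * Real.exp 1 * Real.log (Real.log x) ^ 3 / Real.log x *
          ((x : ℝ) / Real.log x * (1 / Real.log (Real.log x) ^ 2))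
        ≤ C * ((x : ℝ) / Real.log x * (1 / Real.log (Real.log x) ^ 2)) := by gcongr
      _ = C * ((x : ℝ) / Real.log x) * (((1 : ℕ) : ℝ) / Real.log (Real.log x) ^ 2) := by
          push_cast; ring
  · -- `k ≥ 2`
    have hk2' : 2 ≤ k := hk2
    have h := abs_sub_le_case_two_le x hx2 hC₁'pos.le hM hc₀ hCF hL1 hL₂1 hE (hGM x) (hGc x)
      hCFb hk2' hkR
    refine h.trans ?_
    have hmainpos : 0 ≤ satheSelbergG x (((k : ℝ) - 1) / Real.log (Real.log x)) *
        ((x : ℝ) * Real.log (Real.log x) ^ (k - 1) / (((k - 1).factorial : ℝ) * Real.log x)) := by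
      have hr0 : 0 ≤ ((k : ℝ) - 1) / Real.log (Real.log x) := by
        have : (1 : ℝ) ≤ k := by exact_mod_cast hk
        exact div_nonneg (by linarith) hL₂0.le
      have hrR : ((k : ℝ) - 1) / Real.log (Real.log x) ≤ R := by
        rw [div_le_iff₀ hL₂0]; linarith
      have := hGc x _ hr0 hrR
      have hg : 0 ≤ satheSelbergG x (((k : ℝ) - 1) / Real.log (Real.log x)) := hc₀.le.trans this
      positivity
    have hkpos : 0 ≤ (k : ℝ) / Real.log (Real.log x) ^ 2 := by positivity
    gcongr
    calc Real.exp 1 * M * C_F / (Real.pi * c₀) +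
          C₁' * Real.exp 1 * Real.log (Real.log x) ^ 3 / (c₀ * Real.log x)
        ≤ Real.exp 1 * M * C_F / (Real.pi * c₀) + 1 := by linarith
      _ = C := rfl


end Literature.NumberTheory.LFunctions

end
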